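import Literature.NumberTheory.EllipticCurves.ModularFormsGamma0FreeModule
import Literature.NumberTheory.EllipticCurves.ModularCurveGenusIntegralityProofs
import HarnessLib

/-!
# `M(Γ₀(N))` over `ℂ[E₄, E₆]`: rank `μ`, the determinant `𝒟` of the basis-conjugate matrix,
  and the generator weights modulo `4` and `6`
  (trunk EllArithM, item C17; second file of the elementary free-module route to the existence
  half `g(X₀(N)) ≤ dim S₂(Γ₀(N))` of `finrank_cuspForm_two_eq_genusX0`, after
  `ModularFormsGamma0FreeModule`)

`ModularFormsGamma0FreeModule` proved that `A = M(Γ₀(N)) = ⊕ₖ A_k` is free over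
`R = M(SL₂(ℤ)) = ℂ[E₄, E₆]` on homogeneous generators `F_1, …, F_r` of even weights
`k_1, …, k_r ≥ 0` with `r ≤ μ = [SL₂(ℤ) : Γ₀(N)]` (`exists_isLevelOneBasis`). This file proves
`r = μ` and the first three of Gannon's constraints on the weights (Gannon 2014, Thm. 3.4(b) for
`ρ = Ind_{Γ₀(N)}^{SL₂(ℤ)} 1`, whose `T`-, `S`-, `ST`-eigenvalue multiplicities are the numbers of
cosets, `(μ ± ν₂)/2` and `(μ + 2ν₃)/3, (μ - ν₃)/3, (μ - ν₃)/3`):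

  `2·#{j : k_j ≡ 0 (4)} = μ + ν₂`,  `3·#{j : k_j ≡ 0 (6)} = μ + 2ν₃`,
  `3·#{j : k_j ≡ 2 (6)} = 3·#{j : k_j ≡ 4 (6)} = μ - ν₃`

(`two_mul_card_four_dvd`, `three_mul_card_six_dvd`), together with the analytic facts about the
determinant `𝒟 = det Φ`, `Φ(τ)_{a,j} = (F_j ∣_{k_j} γ_a)(τ)` over coset representatives `γ_a`,
that the third file uses at the cusps: `𝒟¹² = cΔ^K` with `c ≠ 0`, `K = ∑ k_j`
(`exists_basisDet_pow_eq_ne_zero`), so `𝒟` has no zero on `ℍ` (`basisDet_ne_zero`) and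
`‖𝒟‖¹² e^{2πK Im τ} → ‖c‖` at `i∞` (`tendsto_norm_basisDet_pow`). Gannon obtains `𝒟 = Δ^{Tr λ}`
from the valence formula; here the valence formula is replaced by the first-order ODE
`D𝒟 = (K/12)E₂𝒟` coming from the Serre derivative, so nothing beyond Mathlib's level-one theory
and the tree's `ModularFormsRamanujan` (`DΔ = E₂Δ`, `E₂ → 1`) is needed.

## Contents and proofs (all `N ≥ 1`)

* Hermite decomposition (`exists_hermite`): `diag(N,1)·g = γ'·(A B; 0 D)` with `γ' ∈ SL₂(ℤ)`,
  `A = gcd(N g₀₀, g₁₀)`, `AD = N`; `A = N ↔ g ∈ Γ₀(N)` (`hermiteA_eq_iff`).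
* `deltaDil N = Δ ∣₁₂ diag(N,1)` (`= N¹¹Δ(Nτ)`) lies in `A₁₂` (`deltaDil_mem`: invariance and
  boundedness of all `SL₂(ℤ)`-translates through the Hermite decomposition), and **its stabiliser
  in `SL₂(ℤ)` is exactly `Γ₀(N)`** (`mem_gamma0_of_deltaDil_slash_eq`): `‖Δ ∣₁₂ (A B; 0 D)‖e^{2π(A/D)y}`
  tends to `A¹¹/D ≠ 0` (`tendsto_norm_discriminant_slash_upperTri`, from `Δ/q → 1`), and the decay
  rate `A/D = A²/N` determines `A`.
* `cosetSlash N k F x = F ∣ₖ g⁻¹` for `x = gΓ₀(N) ∈ SL₂(ℤ)/Γ₀(N)` (well defined for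
  `Γ₀(N)`-invariant `F`; covariance `cosetSlash x ∣ h = cosetSlash (h⁻¹x)`); the `μ` conjugates of
  `Δ_N` are pairwise distinct (`conjDeltaDil_injective`).
* **Rank `≥ μ`**: the `μ` forms `G_i = Δ^{μ-1-i}Δ_N^i ∈ A_{12(μ-1)}` are independent over `R`
  (`explicitForm_indep`: conjugating a relation `∑ p_iG_i = 0` gives `∑ p_i u_x^i = 0` for the `μ`
  distinct functions `u_x = conjugate/Δ`; Vandermonde where their values are distinct, identity
  theorem elsewhere); with `dim A_m = ∑_i dim R_{m-k_i}` for a level-one basis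
  (`IsLevelOneBasis.finrank_eq`) and `dim R_w ≤ w/12 + 1` this forces `r ≥ μ`
  (`IsLevelOneBasis.gamma0Index_le`), hence **`exists_isLevelOneBasis_card_eq`: a level-one basis
  indexed by `Fin μ`** with even weights `≥ 0`. [Gannon2014, Thm. 3.4(a)]
* `D`-calculus (`D = (2πi)⁻¹d/dτ = normalizedDeriv`): sums, Leibniz for finite products,
  `normalizedDeriv_det` (column-by-column); the **Serre derivative preserves `A_k`**
  (`serreDerivative_mem`: Mathlib `serreDerivative_slash_equivariant` for invariance, and for
  boundedness of the translates the tree's `isZeroAtImInfty_normalizedDeriv` applied to the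
  `N`-periodic bounded functions `f ∣ g`).
* The connection matrix (`exists_connection`): `ϑ_{k_j}F_j = ∑_l P_{lj}F_l`, `P_{lj} ∈ R_{k_j+2-k_l}`,
  with **`P_{jj} = 0`** since `R₂ = 0` (Mathlib `ModularForm.levelOne_weight_two_rank_zero` via the
  free-module file); hence `DΦ_{a,j} = ∑_l P_{lj}Φ_{a,l} + (k_j/12)E₂Φ_{a,j}` and, the `P`-part
  being a column operation with zero diagonal, **`D𝒟 = (K/12)E₂𝒟`** (`normalizedDeriv_basisDet`).
* **`𝒟¹² = cΔ^K`** (`exists_basisDet_pow_eq`): `𝒟¹²/Δ^K` has zero derivative on `ℍ`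
  (`DΔ = E₂Δ`), so it is constant (Mathlib `Convex.is_const_of_fderivWithin_eq_zero` on the
  half-plane, through `ofComplex`). **`𝒟 ≢ 0`** (`exists_basisDet_ne_zero`): expressing the independent explicit
  forms `G_i` in the basis, `(G_i ∣ γ_a) = Φ · (coefficient matrix)`, and the left side has
  Vandermonde determinant `Δ^{…}∏(u_x - u_y) ≢ 0`. So `c ≠ 0`, `𝒟(τ) ≠ 0` for every `τ ∈ ℍ`, and
  `‖𝒟‖¹²e^{2πKy} → ‖c‖`.
* Eigenvectors of a permutation `σ` of prime order `p` on `Fin μ` (`PermEigen`): a linearly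
  independent family of vectors `v_i` with `v_i ∘ σ = t_iv_i` has `p·#{i : t_i = c} + #Fix(σ) ≤ μ`
  for `c ≠ 1` and `p·#{i : t_i = 1} ≤ μ + (p-1)#Fix(σ)` (`eigenCount_le`: restriction to a set of
  orbit representatives `permReps` plus the fixed points is injective on each eigenspace).
* Elliptic points: for `h ∈ SL₂(ℤ)` with `hᵖ = -1` fixing `z₀` (`h = S, z₀ = i, p = 2`;
  `h = ST, z₀ = ρ, p = 3`), right multiplication permutes the rows of `Φ(z₀)` and
  `Φ(z₀)_{a·h, j} = j(h, z₀)^{-k_j}Φ(z₀)_{a,j}` (`basisMatrix_cosetPermFin`); the columns of `Φ(z₀)`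
  are independent because `𝒟(z₀) ≠ 0`; the number of fixed cosets is `ν₂` resp. `ν₃`
  (tree `card_fixed_S_eq_nu₂`, `card_fixed_TS_eq_nu₃`, `card_fixed_TS_eq_card_fixed_ST` of
  `ModularCurveEllipticPointsProofs`);
  and `j(S,i)^{-k} = i^{-k}`, `j(ST,ρ)^{-k} = (ρ+1)^{-k}` are read off `k mod 4`, `k mod 6`. The two
  inequalities of `eigenCount_le` for each eigenvalue then add up to equalities
  (`two_mul_card_four_dvd`, `three_mul_card_six_dvd`). [Gannon2014, Thm. 3.4(b)]

No named facts; auxiliary definitions only (`upperTri`, `hermiteA/D`, `deltaDil`, `cosetSlash`,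
`conjDeltaDil`, `explicitForm`, `cosetEquiv`, `basisMatrix`, `basisDet`, `totalWeight`,
`permEigenvectors`, `permReps`, `cosetPermFin`). Everything is in `namespace Literature.ModularForms`
and proved.

## References

* T. Gannon, *The theory of vector-valued modular forms for the modular group*, Contrib. Math.
  Comput. Sci. 8, Springer (2014), 247–286 (arXiv:1310.4458), Thm. 3.4 and its proof (§3.4),
  §3.5. [Gannon2014]
* C. Marks, G. Mason, *Structure of the module of vector-valued modular forms*, J. London Math.
  Soc. (2) 82 (2010), 32–48, Thm. 1 and §3 (the determinant argument). [MarksMason2010]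
* F. Diamond, J. Shurman, *A first course in modular forms*, GTM 228, Springer (2005), Thm. 3.5.1
  (the dimension formula this route proves the existence half of).
-/

noncomputable section

open UpperHalfPlane hiding I
open ModularForm Complex Matrix.SpecialLinearGroup Filter Asymptotics CongruenceSubgroup
open EisensteinSeries ModularGroup
open scoped MatrixGroups Real ModularForm Topology Manifold

namespace Literature.NumberTheory.EllipticCurves.ModularForms

/-! ### Upper triangular matrices `(A B; 0 D)` and the Hermite decomposition of `diag(N,1)·g` -/

section UpperTri

/-- The matrix `(A B; 0 D) ∈ GL(2, ℝ)⁺` for `A, D ≥ 1`, `B ∈ ℤ`. [folklore] -/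
def upperTri (A D : ℕ) (B : ℤ) [NeZero A] [NeZero D] : GL (Fin 2) ℝ :=
  Matrix.GeneralLinearGroup.mkOfDetNeZero !![(A : ℝ), (B : ℝ); 0, (D : ℝ)] (by
    rw [Matrix.det_fin_two_of]
    simp [NeZero.ne A, NeZero.ne D])

variable (A D : ℕ) (B : ℤ) [NeZero A] [NeZero D]

/-- The underlying matrix of `upperTri`. [folklore] -/
@[simp] theorem val_upperTri :
    ((upperTri A D B : GL (Fin 2) ℝ) : Matrix (Fin 2) (Fin 2) ℝ) = !![(A : ℝ), (B : ℝ); 0, (D : ℝ)] :=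
  rfl

/-- `det (A B; 0 D) = AD > 0`. [folklore] -/
theorem det_upperTri : (upperTri A D B).det.val = (A : ℝ) * D := by
  simp [Matrix.GeneralLinearGroup.val_det_apply, Matrix.det_fin_two_of]

/-- `det (A B; 0 D) > 0`. [folklore] -/
theorem det_upperTri_pos : 0 < (upperTri A D B).det.val := by
  rw [det_upperTri]
  exact mul_pos (by exact_mod_cast NeZero.pos A) (by exact_mod_cast NeZero.pos D)

/-- `j((A B; 0 D), τ) = D`. [folklore] -/
theorem denom_upperTri (τ : ℍ) : denom (upperTri A D B) τ = D := by
  simp [denom]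

/-- `(A B; 0 D) · τ = (Aτ + B)/D`. [folklore] -/
theorem coe_upperTri_smul (τ : ℍ) :
    ((upperTri A D B • τ : ℍ) : ℂ) = ((A : ℂ) * τ + B) / D := by
  rw [coe_smul_of_det_pos (det_upperTri_pos A D B), denom_upperTri]
  simp [num]

/-- `Im ((A B; 0 D) · τ) = (A/D) Im τ`. [folklore] -/
theorem im_upperTri_smul (τ : ℍ) :
    (upperTri A D B • τ).im = (A : ℝ) / D * τ.im := by
  rw [← UpperHalfPlane.coe_im, coe_upperTri_smul]
  have hD : (D : ℂ) ≠ 0 := by exact_mod_cast NeZero.ne D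
  rw [show ((A : ℂ) * τ + B) / D = ((A : ℝ) / D : ℝ) * (τ : ℂ) + ((B : ℝ) / D : ℝ) by
    push_cast; field_simp]
  simp [Complex.mul_im]

/-- Mathlib's `σ g` is the identity for `det g > 0`. [folklore] -/
theorem σ_upperTri (z : ℂ) : σ (upperTri A D B) z = z := by
  rw [σ, if_pos (det_upperTri_pos A D B)]
  rfl

/-- `(f ∣ₖ (A B; 0 D))(τ) = (AD)^{k-1} D^{-k} f((Aτ+B)/D)`. [folklore] -/
theorem slash_upperTri_apply (k : ℤ) (f : ℍ → ℂ) (τ : ℍ) :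
    (f ∣[k] upperTri A D B) τ =
      ((A : ℂ) * D) ^ (k - 1) * (D : ℂ) ^ (-k) * f (upperTri A D B • τ) := by
  rw [ModularForm.slash_apply, σ_upperTri, det_upperTri, denom_upperTri,
    abs_of_pos (mul_pos (by exact_mod_cast NeZero.pos A) (by exact_mod_cast NeZero.pos D))]
  push_cast
  ring

/-- `upperTri` only depends on the numbers `A, D` (not on the `NeZero` witnesses). [folklore] -/
theorem upperTri_eq_of_eq {A' D' : ℕ} [NeZero A'] [NeZero D'] (hA : A = A') (hD : D = D') :
    upperTri A D B = upperTri A' D' B := by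
  subst hA
  subst hD
  rfl

end UpperTri

section Hermite

variable (N : ℕ) [NeZero N]

/-- The first-column gcd `A(g) = gcd(N·g₀₀, g₁₀)` of `diag(N,1)·g`. [folklore] -/
def hermiteA (g : SL(2, ℤ)) : ℕ := Int.gcd (N * g 0 0) (g 1 0)

omit [NeZero N] in
/-- `A(g)` divides `N` (since `gcd(g₀₀, g₁₀) = 1`). [folklore] -/
theorem hermiteA_dvd (g : SL(2, ℤ)) : hermiteA N g ∣ N := by
  unfold hermiteA
  have hdet : g 0 0 * g 1 1 - g 0 1 * g 1 0 = 1 := by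
    have := Matrix.det_fin_two (g : Matrix (Fin 2) (Fin 2) ℤ)
    rw [g.det_coe] at this
    linarith
  have h1 : (Int.gcd (N * g 0 0) (g 1 0) : ℤ) ∣ N * g 0 0 := Int.gcd_dvd_left ..
  have h2 : (Int.gcd (N * g 0 0) (g 1 0) : ℤ) ∣ g 1 0 := Int.gcd_dvd_right ..
  have e : (N : ℤ) = (N * g 0 0) * g 1 1 - g 0 1 * (g 1 0) * N := by
    linear_combination (-(N : ℤ)) * hdet
  have : (Int.gcd (N * g 0 0) (g 1 0) : ℤ) ∣ (N * g 0 0) * g 1 1 - g 0 1 * (g 1 0) * N :=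
    dvd_sub (dvd_mul_of_dvd_left h1 _) (dvd_mul_of_dvd_left (dvd_mul_of_dvd_right h2 _) _)
  rw [← e] at this
  exact_mod_cast this

/-- `A(g) ≥ 1`. [folklore] -/
theorem hermiteA_pos (g : SL(2, ℤ)) : 0 < hermiteA N g :=
  Nat.pos_of_dvd_of_pos (hermiteA_dvd N g) (NeZero.pos N)

omit [NeZero N] in
/-- `A(g) = N` iff `N ∣ g₁₀`, i.e. iff `g ∈ Γ₀(N)`. [folklore] -/
theorem hermiteA_eq_iff (g : SL(2, ℤ)) : hermiteA N g = N ↔ g ∈ Gamma0 N := by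
  rw [Gamma0_mem, hermiteA]
  constructor
  · intro h
    have h2 : (Int.gcd (N * g 0 0) (g 1 0) : ℤ) ∣ g 1 0 := Int.gcd_dvd_right ..
    rw [h] at h2
    exact (ZMod.intCast_zmod_eq_zero_iff_dvd _ N).mpr h2
  · intro h
    have h2 : (N : ℤ) ∣ g 1 0 := (ZMod.intCast_zmod_eq_zero_iff_dvd _ N).mp h
    apply Nat.dvd_antisymm (hermiteA_dvd N g)
    have : (N : ℤ) ∣ (Int.gcd (N * g 0 0) (g 1 0) : ℤ) :=
      Int.dvd_coe_gcd (dvd_mul_right _ _) h2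
    exact_mod_cast this

/-- `D(g) = N / A(g)`. [folklore] -/
def hermiteD (g : SL(2, ℤ)) : ℕ := N / hermiteA N g

omit [NeZero N] in
/-- `A(g) D(g) = N`. [folklore] -/
theorem hermiteA_mul_hermiteD (g : SL(2, ℤ)) : hermiteA N g * hermiteD N g = N :=
  Nat.mul_div_cancel' (hermiteA_dvd N g)

/-- `A(g) ≠ 0` (needed to form `upperTri (hermiteA N g) _ _`). [folklore] -/
instance (g : SL(2, ℤ)) : NeZero (hermiteA N g) := ⟨(hermiteA_pos N g).ne'⟩

/-- `D(g) ≠ 0` (needed to form `upperTri _ (hermiteD N g) _`). [folklore] -/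
instance (g : SL(2, ℤ)) : NeZero (hermiteD N g) :=
  ⟨fun h ↦ by have := hermiteA_mul_hermiteD N g; rw [h, mul_zero] at this; exact NeZero.ne N this.symm⟩

/-- **Hermite decomposition**: `diag(N, 1) · g = γ' · (A B; 0 D)` with `γ' ∈ SL₂(ℤ)`,
`A = gcd(Ng₀₀, g₁₀)`, `AD = N`, for every `g ∈ SL₂(ℤ)`. [folklore] -/
theorem exists_hermite (g : SL(2, ℤ)) : ∃ (γ' : SL(2, ℤ)) (B : ℤ),
    (upperTri N 1 0 : GL (Fin 2) ℝ) * (g : GL (Fin 2) ℝ) =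
      (γ' : GL (Fin 2) ℝ) * upperTri (hermiteA N g) (hermiteD N g) B := by
  have hdet : g 0 0 * g 1 1 - g 0 1 * g 1 0 = 1 := by
    have := Matrix.det_fin_two (g : Matrix (Fin 2) (Fin 2) ℤ)
    rw [g.det_coe] at this
    linarith
  set a := g 0 0
  set b := g 0 1
  set c := g 1 0
  set d := g 1 1
  set A : ℤ := (hermiteA N g : ℤ) with hA
  have hA0 : A ≠ 0 := by rw [hA]; exact_mod_cast (hermiteA_pos N g).ne'
  obtain ⟨p', hp'⟩ : A ∣ N * a := Int.gcd_dvd_left ..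
  obtain ⟨r', hr'⟩ : A ∣ c := Int.gcd_dvd_right ..
  set D : ℤ := (hermiteD N g : ℤ) with hD
  have hAD : A * D = N := by rw [hA, hD]; exact_mod_cast hermiteA_mul_hermiteD N g
  -- Bezout
  set x : ℤ := Int.gcdA (N * a) c
  set y : ℤ := Int.gcdB (N * a) c
  have hbez : N * a * x + c * y = A := (Int.gcd_eq_gcd_ab (N * a) c).symm
  have hbez' : p' * x + r' * y = 1 := by
    have : A * (p' * x + r' * y - 1) = 0 := by
      linear_combination (hp' ▸ hr' ▸ hbez : (A * p') * x + (A * r') * y = A)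
    rcases mul_eq_zero.mp this with h | h
    · exact absurd h hA0
    · linarith
  -- the key identity `p' d - D = b r' N`
  have hkey : p' * d - D = b * r' * N := by
    have e1 : A * (p' * d - D) = A * (b * r' * N) := by
      linear_combination (-d) * hp' - hAD + (b * N) * hr' + (N : ℤ) * hdet
    exact mul_left_cancel₀ hA0 e1
  let γ' : SL(2, ℤ) := ⟨!![p', -y; r', x], by rw [Matrix.det_fin_two_of]; linear_combination hbez'⟩
  refine ⟨γ', x * N * b + y * d, ?_⟩
  ext i j
  -- compare matrices in `GL(2, ℝ)` entrywise
  simp only [Matrix.GeneralLinearGroup.coe_mul, val_upperTri]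
  have hg : ((g : GL (Fin 2) ℝ) : Matrix (Fin 2) (Fin 2) ℝ) = !![(a : ℝ), (b : ℝ); (c : ℝ), (d : ℝ)] := by
    ext i j
    fin_cases i <;> fin_cases j <;> rfl
  have hγ : ((γ' : GL (Fin 2) ℝ) : Matrix (Fin 2) (Fin 2) ℝ) = !![(p' : ℝ), (-y : ℝ); (r' : ℝ), (x : ℝ)] := by
    ext i j
    fin_cases i <;> fin_cases j <;> simp [γ']
  rw [hg, hγ]
  have eA : ((hermiteA N g : ℕ) : ℝ) = (A : ℝ) := by simp [hA]
  have eD : ((hermiteD N g : ℕ) : ℝ) = (D : ℝ) := by simp [hD]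
  have hp'R : (N : ℝ) * a = A * p' := by exact_mod_cast hp'
  have hr'R : (c : ℝ) = A * r' := by exact_mod_cast hr'
  have hbezR : (p' : ℝ) * x + r' * y = 1 := by exact_mod_cast hbez'
  have hkeyR : (p' : ℝ) * d - D = b * r' * N := by exact_mod_cast hkey
  fin_cases i <;> fin_cases j <;>
    simp [Matrix.mul_apply, Fin.sum_univ_two, eA, eD]
  · linear_combination hp'R
  · linear_combination (-(N : ℝ) * b) * hbezR + (-(y : ℝ)) * hkeyR
  · linear_combination hr'R
  · linear_combination (-(d : ℝ)) * hbezR + (x : ℝ) * hkeyR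

end Hermite

/-! ### The form `Δ_N = Δ ∣₁₂ diag(N,1)` of level `Γ₀(N)` and its stabiliser -/

section DeltaDil

variable (N : ℕ) [NeZero N]

/-- `Δ_N := Δ ∣₁₂ (N 0; 0 1) = N¹¹ Δ(Nτ)`, a weight-`12` cusp form for `Γ₀(N)`. [folklore] -/
def deltaDil : ℍ → ℂ := ModularForm.discriminant ∣[(12 : ℤ)] upperTri N 1 0

/-- `(N B; 0 1) = Tᴮ · (N 0; 0 1)`. [folklore] -/
theorem upperTri_one_eq (B : ℤ) :
    (upperTri N 1 B : GL (Fin 2) ℝ) =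
      ((ModularGroup.T ^ B : SL(2, ℤ)) : GL (Fin 2) ℝ) * upperTri N 1 0 := by
  ext i j
  simp only [Matrix.GeneralLinearGroup.coe_mul, val_upperTri]
  have hT : (((ModularGroup.T ^ B : SL(2, ℤ)) : GL (Fin 2) ℝ) : Matrix (Fin 2) (Fin 2) ℝ) =
      !![1, (B : ℝ); 0, 1] := by
    ext i j
    have hij : ((((ModularGroup.T ^ B : SL(2, ℤ)) : GL (Fin 2) ℝ) : Matrix (Fin 2) (Fin 2) ℝ) i j)
        = (((ModularGroup.T ^ B : SL(2, ℤ)) : Matrix (Fin 2) (Fin 2) ℤ) i j : ℝ) := rfl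
    rw [hij, ModularGroup.coe_T_zpow]
    fin_cases i <;> fin_cases j <;> simp
  rw [hT]
  fin_cases i <;> fin_cases j <;> simp [Matrix.mul_apply, Fin.sum_univ_two]

/-- Slashing a level-one form through the Hermite decomposition:
`(f ∣ diag(N,1)) ∣ g = f ∣ (A B; 0 D)`. [folklore] -/
theorem slash_upperTri_slash {k : ℤ} {f : ℍ → ℂ} (hf : ∀ γ : SL(2, ℤ), f ∣[k] (γ : GL (Fin 2) ℝ) = f)
    (g : SL(2, ℤ)) : ∃ B : ℤ,
    (f ∣[k] upperTri N 1 0) ∣[k] (g : GL (Fin 2) ℝ) = f ∣[k] upperTri (hermiteA N g) (hermiteD N g) B := by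
  obtain ⟨γ', B, h⟩ := exists_hermite N g
  refine ⟨B, ?_⟩
  rw [← SlashAction.slash_mul, h, SlashAction.slash_mul, hf γ']

/-- `Δ` is invariant under `SL₂(ℤ)`. [folklore] -/
theorem discriminant_slash (γ : SL(2, ℤ)) :
    ModularForm.discriminant ∣[(12 : ℤ)] (γ : GL (Fin 2) ℝ) = ModularForm.discriminant := by
  have := CuspForm.discriminant.slash_action_eq' (γ : GL (Fin 2) ℝ) ⟨γ, rfl⟩
  simpa using this

/-- `Δ(τ)/q(τ) → 1` at `i∞` (`Δ = q ∏ (1 - qⁿ)²⁴`). [folklore] -/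
theorem tendsto_discriminant_div_qParam :
    Tendsto (fun τ : ℍ ↦ ModularForm.discriminant τ / Function.Periodic.qParam 1 τ) atImInfty (𝓝 1) := by
  refine (tendsto_atImInfty_tprod_one_sub_eta_q_pow).congr fun τ ↦ ?_
  rw [discriminant_eq_q_prod τ, mul_div_cancel_left₀ _ (Function.Periodic.qParam_ne_zero _)]

/-- `‖Δ(τ)‖ e^{2π Im τ} → 1` at `i∞`. [folklore] -/
theorem tendsto_norm_discriminant_mul_exp :
    Tendsto (fun τ : ℍ ↦ ‖ModularForm.discriminant τ‖ * Real.exp (2 * π * τ.im)) atImInfty (𝓝 1) := by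
  have h := tendsto_discriminant_div_qParam.norm
  rw [norm_one] at h
  refine h.congr fun τ ↦ ?_
  rw [norm_div, Function.Periodic.norm_qParam]
  have : Real.exp (-2 * π * Complex.im (τ : ℂ) / 1) = (Real.exp (2 * π * τ.im))⁻¹ := by
    rw [← Real.exp_neg, UpperHalfPlane.coe_im]
    exact congrArg Real.exp (by ring)
  rw [this, div_inv_eq_mul]

variable {N} in
/-- `(A B; 0 D) · τ → i∞` as `τ → i∞`. [folklore] -/
theorem tendsto_upperTri_smul (A D : ℕ) (B : ℤ) [NeZero A] [NeZero D] :
    Tendsto (fun τ : ℍ ↦ upperTri A D B • τ) atImInfty atImInfty := by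
  rw [atImInfty_basis.tendsto_iff atImInfty_basis]
  intro c _
  have hpos : 0 < (A : ℝ) / D := div_pos (by exact_mod_cast NeZero.pos A) (by exact_mod_cast NeZero.pos D)
  refine ⟨c / ((A : ℝ) / D), trivial, fun τ hτ ↦ ?_⟩
  simp only [Set.mem_preimage, Set.mem_Ici] at hτ ⊢
  rw [im_upperTri_smul]
  rwa [div_le_iff₀ hpos, mul_comm] at hτ

/-- **Asymptotics of `Δ ∣ (A B; 0 D)`**: `‖(Δ ∣₁₂ (A B; 0 D))(τ)‖ · e^{2π (A/D) Im τ} → A¹¹/D`.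
[folklore] -/
theorem tendsto_norm_discriminant_slash_upperTri (A D : ℕ) (B : ℤ) [NeZero A] [NeZero D] :
    Tendsto (fun τ : ℍ ↦ ‖(ModularForm.discriminant ∣[(12 : ℤ)] upperTri A D B) τ‖ *
      Real.exp (2 * π * ((A : ℝ) / D * τ.im))) atImInfty (𝓝 ((A : ℝ) ^ 11 / D)) := by
  have hA : (0 : ℝ) < A := by exact_mod_cast NeZero.pos A
  have hD : (0 : ℝ) < D := by exact_mod_cast NeZero.pos D
  have h := (tendsto_norm_discriminant_mul_exp.comp (tendsto_upperTri_smul A D B)).const_mul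
    ((A : ℝ) ^ 11 / D)
  rw [mul_one] at h
  refine h.congr fun τ ↦ ?_
  simp only [Function.comp_apply]
  rw [slash_upperTri_apply, im_upperTri_smul, norm_mul, norm_mul]
  have e1 : ‖((A : ℂ) * D) ^ ((12 : ℤ) - 1)‖ = ((A : ℝ) * D) ^ 11 := by
    rw [show (12 : ℤ) - 1 = (11 : ℕ) by norm_num, zpow_natCast, norm_pow, norm_mul,
      Complex.norm_natCast, Complex.norm_natCast]
  have e2 : ‖(D : ℂ) ^ (-(12 : ℤ))‖ = ((D : ℝ) ^ 12)⁻¹ := by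
    rw [zpow_neg, norm_inv, show (12 : ℤ) = (12 : ℕ) by norm_num, zpow_natCast, norm_pow,
      Complex.norm_natCast]
  rw [e1, e2]
  field_simp

/-- `Δ_N(τ)` decays exactly like `e^{-2πN Im τ}`: `‖Δ_N(τ)‖ e^{2πN Im τ} → N¹¹`. [folklore] -/
theorem tendsto_norm_deltaDil :
    Tendsto (fun τ : ℍ ↦ ‖deltaDil N τ‖ * Real.exp (2 * π * (N * τ.im))) atImInfty (𝓝 ((N : ℝ) ^ 11)) := by
  have h := tendsto_norm_discriminant_slash_upperTri N 1 0
  simp only [Nat.cast_one, div_one] at h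
  exact h

/-- **The stabiliser of `Δ_N` in `SL₂(ℤ)` is `Γ₀(N)`**: if `Δ_N ∣₁₂ g = Δ_N` then `g ∈ Γ₀(N)`
(compare the decay rates `e^{-2πN y}` of `Δ_N` and `e^{-2π(A/D)y}` of `Δ_N ∣ g = Δ ∣ (A B; 0 D)`,
where `A/D < N` unless `A = N`, i.e. unless `N ∣ g₁₀`). [folklore] -/
theorem mem_gamma0_of_deltaDil_slash_eq {g : SL(2, ℤ)}
    (h : deltaDil N ∣[(12 : ℤ)] (g : GL (Fin 2) ℝ) = deltaDil N) : g ∈ Gamma0 N := by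
  by_contra hg
  obtain ⟨B, hB⟩ := slash_upperTri_slash N discriminant_slash g
  change deltaDil N ∣[(12 : ℤ)] (g : GL (Fin 2) ℝ) = _ at hB
  rw [h] at hB
  -- `A < N`, `D ≥ 2`, `A/D < N`
  set A := hermiteA N g with hA
  set D := hermiteD N g with hD
  have hAN : A ≠ N := fun e ↦ hg ((hermiteA_eq_iff N g).mp e)
  have hAle : A ≤ N := Nat.le_of_dvd (NeZero.pos N) (hermiteA_dvd N g)
  have hAlt : A < N := lt_of_le_of_ne hAle hAN
  have hADN : A * D = N := hermiteA_mul_hermiteD N g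
  have hD2 : 2 ≤ D := by
    by_contra hlt
    have hD1 : D = 1 := by
      have := NeZero.pos D
      omega
    rw [hD1, mul_one] at hADN
    exact hAN hADN
  have hrate : (A : ℝ) / D < N := by
    rw [div_lt_iff₀ (by positivity)]
    have : (A : ℝ) < N := by exact_mod_cast hAlt
    have : (2 : ℝ) ≤ D := by exact_mod_cast hD2
    nlinarith [(Nat.cast_nonneg N : (0 : ℝ) ≤ N)]
  -- two limits for `‖Δ_N(τ)‖ e^{2π (A/D) y}`
  have h1 : Tendsto (fun τ : ℍ ↦ ‖deltaDil N τ‖ * Real.exp (2 * π * ((A : ℝ) / D * τ.im)))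
      atImInfty (𝓝 ((A : ℝ) ^ 11 / D)) := by
    have := tendsto_norm_discriminant_slash_upperTri A D B
    rw [← hB] at this
    exact this
  have h2 : Tendsto (fun τ : ℍ ↦ ‖deltaDil N τ‖ * Real.exp (2 * π * ((A : ℝ) / D * τ.im)))
      atImInfty (𝓝 0) := by
    have hdecay : Tendsto (fun τ : ℍ ↦ Real.exp (-(2 * π * ((N : ℝ) - A / D)) * τ.im))
        atImInfty (𝓝 0) := by
      have hc : 0 < 2 * π * ((N : ℝ) - A / D) := by
        have := Real.pi_pos
        nlinarith
      refine Real.tendsto_exp_atBot.comp ?_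
      have him : Tendsto (fun τ : ℍ ↦ τ.im) atImInfty atTop := Filter.tendsto_comap
      have := tendsto_neg_atTop_atBot.comp ((tendsto_id.const_mul_atTop hc).comp him)
      refine this.congr fun τ ↦ ?_
      simp only [Function.comp_apply, id_eq, neg_mul]
    have := (tendsto_norm_deltaDil N).mul hdecay
    rw [mul_zero] at this
    refine this.congr fun τ ↦ ?_
    rw [mul_assoc, ← Real.exp_add]
    congr 2
    ring
  have := tendsto_nhds_unique h1 h2
  have hpos : (0 : ℝ) < (A : ℝ) ^ 11 / D := by
    have := hermiteA_pos N g
    positivity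
  exact hpos.ne' this

/-- **`Δ_N ∈ M₁₂(Γ₀(N))`** (in fact a cusp form): invariance through the Hermite decomposition
(`A = N`, `(N B; 0 1) = Tᴮ diag(N,1)`), boundedness at every cusp since `Δ_N ∣ g = Δ ∣ (A B; 0 D)`
decays like `e^{-2π(A/D)y}`. [folklore] -/
theorem deltaDil_mem : deltaDil N ∈ gamma0Space N 12 := by
  rw [mem_formSpace_iff]
  refine ⟨?_, ?_, ?_⟩
  · exact CuspForm.discriminant.holo'.slash _ _
  · rintro _ ⟨γ, hγ, rfl⟩
    obtain ⟨B, hB⟩ := slash_upperTri_slash N discriminant_slash γ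
    change deltaDil N ∣[(12 : ℤ)] (γ : GL (Fin 2) ℝ) = _ at hB
    show deltaDil N ∣[(12 : ℤ)] (γ : GL (Fin 2) ℝ) = deltaDil N
    have hA : hermiteA N γ = N := (hermiteA_eq_iff N γ).mpr hγ
    have hD : hermiteD N γ = 1 := by
      have := hermiteA_mul_hermiteD N γ
      rw [hA] at this
      exact (Nat.mul_eq_left (NeZero.ne N)).mp this
    rw [hB, upperTri_eq_of_eq _ _ _ hA hD, upperTri_one_eq, SlashAction.slash_mul, discriminant_slash]
    rfl
  · intro g
    obtain ⟨B, hB⟩ := slash_upperTri_slash N discriminant_slash g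
    change deltaDil N ∣[(12 : ℤ)] (g : GL (Fin 2) ℝ) = _ at hB
    rw [hB]
    -- `Δ ∣ (A B; 0 D)` is bounded: `Δ` bounded at `i∞`, `(A B; 0 D)·τ → i∞`
    have hbd : IsBoundedAtImInfty (fun τ : ℍ ↦ ModularForm.discriminant (upperTri (hermiteA N g) (hermiteD N g) B • τ)) :=
      (ModularFormClass.bdd_at_infty CuspForm.discriminant).comp_tendsto (tendsto_upperTri_smul _ _ _)
    have : (ModularForm.discriminant ∣[(12 : ℤ)] upperTri (hermiteA N g) (hermiteD N g) B) =
        fun τ ↦ (((hermiteA N g : ℂ) * (hermiteD N g)) ^ ((12 : ℤ) - 1) * ((hermiteD N g : ℂ)) ^ (-(12 : ℤ))) *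
          ModularForm.discriminant (upperTri (hermiteA N g) (hermiteD N g) B • τ) := by
      funext τ
      rw [slash_upperTri_apply]
    rw [this]
    exact hbd.const_mul_left _

/-! ### Conjugates of `Γ₀(N)`-forms over `SL₂(ℤ)/Γ₀(N)` -/

/-- The translate `F ∣ₖ g⁻¹` attached to a coset `x = gΓ₀(N)` (via the chosen representative
`x.out`; independent of the representative for `Γ₀(N)`-invariant `F`, `cosetSlash_mk`). [folklore] -/
def cosetSlash (k : ℤ) (F : ℍ → ℂ) (x : SL(2, ℤ) ⧸ Gamma0 N) : ℍ → ℂ :=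
  F ∣[k] ((x.out⁻¹ : SL(2, ℤ)) : GL (Fin 2) ℝ)

variable {N}

/-- Coercion `SL₂(ℤ) → GL(2,ℝ)` is multiplicative. [folklore] -/
theorem coeGL_mul (g h : SL(2, ℤ)) :
    ((g * h : SL(2, ℤ)) : GL (Fin 2) ℝ) = (g : GL (Fin 2) ℝ) * (h : GL (Fin 2) ℝ) :=
  map_mul (mapGL ℝ) g h

/-- Coercion `SL₂(ℤ) → GL(2,ℝ)` respects inverses. [folklore] -/
theorem coeGL_inv (g : SL(2, ℤ)) : ((g⁻¹ : SL(2, ℤ)) : GL (Fin 2) ℝ) = (g : GL (Fin 2) ℝ)⁻¹ :=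
  map_inv (mapGL ℝ) g

omit [NeZero N] in
/-- `cosetSlash` on `⟦g⟧` is `F ∣ g⁻¹` for `Γ₀(N)`-invariant `F`. [folklore] -/
theorem cosetSlash_mk {k : ℤ} {F : ℍ → ℂ} (hF : ∀ γ ∈ Gamma0 N, F ∣[k] (γ : GL (Fin 2) ℝ) = F)
    (g : SL(2, ℤ)) :
    cosetSlash N k F (g : SL(2, ℤ) ⧸ Gamma0 N) = F ∣[k] ((g⁻¹ : SL(2, ℤ)) : GL (Fin 2) ℝ) := by
  obtain ⟨γ₀, hγ₀⟩ := QuotientGroup.mk_out_eq_mul (Gamma0 N) g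
  unfold cosetSlash
  rw [hγ₀, mul_inv_rev, coeGL_mul, SlashAction.slash_mul, hF _ (inv_mem γ₀.2)]

omit [NeZero N] in
/-- Invariance in the form needed: members of `A_k` are `Γ₀(N)`-invariant. [folklore] -/
theorem slash_eq_of_mem_gamma0Space {k : ℤ} {F : ℍ → ℂ} (hF : F ∈ gamma0Space N k) :
    ∀ γ ∈ Gamma0 N, F ∣[k] (γ : GL (Fin 2) ℝ) = F :=
  fun γ hγ ↦ slash_eq_of_mem_formSpace hF ⟨γ, hγ, rfl⟩

omit [NeZero N] in
/-- **Covariance**: `(cosetSlash x) ∣ h = cosetSlash (h⁻¹ · x)` for `h ∈ SL₂(ℤ)`. [folklore] -/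
theorem cosetSlash_slash {k : ℤ} {F : ℍ → ℂ} (hF : ∀ γ ∈ Gamma0 N, F ∣[k] (γ : GL (Fin 2) ℝ) = F)
    (x : SL(2, ℤ) ⧸ Gamma0 N) (h : SL(2, ℤ)) :
    cosetSlash N k F x ∣[k] (h : GL (Fin 2) ℝ) = cosetSlash N k F (h⁻¹ • x) := by
  induction x using QuotientGroup.induction_on with
  | H g =>
    rw [cosetSlash_mk hF, show h⁻¹ • (g : SL(2, ℤ) ⧸ Gamma0 N) = ((h⁻¹ * g : SL(2, ℤ)) : SL(2, ℤ) ⧸ Gamma0 N)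
      from rfl, cosetSlash_mk hF, ← SlashAction.slash_mul, ← coeGL_mul, mul_inv_rev, inv_inv]

omit [NeZero N] in
/-- `cosetSlash` of a member of `A_k` is holomorphic. [folklore] -/
theorem mdifferentiable_cosetSlash {k : ℤ} {F : ℍ → ℂ} (hF : F ∈ gamma0Space N k)
    (x : SL(2, ℤ) ⧸ Gamma0 N) : MDiff (cosetSlash N k F x) :=
  (mdifferentiable_of_mem_formSpace hF).slash _ _

/-- `cosetSlash` of a member of `A_k` is bounded at `i∞`. [folklore] -/
theorem isBoundedAtImInfty_cosetSlash {k : ℤ} {F : ℍ → ℂ} (hF : F ∈ gamma0Space N k)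
    (x : SL(2, ℤ) ⧸ Gamma0 N) : IsBoundedAtImInfty (cosetSlash N k F x) :=
  isBoundedAtImInfty_slash_of_mem_formSpace hF _

variable (N)

/-- The conjugates `v_x = Δ_N ∣ g⁻¹` (`x = gΓ₀(N)`) of `Δ_N`. [folklore] -/
def conjDeltaDil (x : SL(2, ℤ) ⧸ Gamma0 N) : ℍ → ℂ := cosetSlash N 12 (deltaDil N) x

/-- **The `μ` conjugates of `Δ_N` are pairwise distinct** (the stabiliser of `Δ_N` is `Γ₀(N)`).
[folklore] -/
theorem conjDeltaDil_injective : Function.Injective (conjDeltaDil N) := by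
  intro x y hxy
  induction x using QuotientGroup.induction_on with
  | H g =>
  induction y using QuotientGroup.induction_on with
  | H g' =>
    have hF := slash_eq_of_mem_gamma0Space (deltaDil_mem N)
    simp only [conjDeltaDil, cosetSlash_mk hF] at hxy
    -- `Δ_N ∣ (g⁻¹ g') = Δ_N`
    have : deltaDil N ∣[(12 : ℤ)] (((g⁻¹ * g' : SL(2, ℤ))) : GL (Fin 2) ℝ) = deltaDil N := by
      have := congrArg (fun f : ℍ → ℂ ↦ f ∣[(12 : ℤ)] ((g' : SL(2, ℤ)) : GL (Fin 2) ℝ)) hxy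
      simp only [← SlashAction.slash_mul, ← coeGL_mul, inv_mul_cancel] at this
      simpa using this
    exact QuotientGroup.eq.mpr (mem_gamma0_of_deltaDil_slash_eq N this)

/-- The conjugates are holomorphic. [folklore] -/
theorem mdifferentiable_conjDeltaDil (x : SL(2, ℤ) ⧸ Gamma0 N) : MDiff (conjDeltaDil N x) :=
  mdifferentiable_cosetSlash (deltaDil_mem N) x

end DeltaDil

/-! ### `μ` forms independent over `M(SL₂(ℤ))`: `Δ^{μ-1-i} Δ_N^i`, and the rank `r ≥ μ` -/

section Rank

variable (N : ℕ) [NeZero N]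

/-- Powers under the `SL₂(ℤ)` slash action: `(fⁿ) ∣_{nk} A = (f ∣ₖ A)ⁿ`. [folklore] -/
theorem pow_slash_SL2 (k : ℤ) (A : SL(2, ℤ)) (f : ℍ → ℂ) (n : ℕ) :
    (f ^ n) ∣[(n : ℤ) * k] A = (f ∣[k] A) ^ n := by
  induction n with
  | zero =>
    simp only [pow_zero, Nat.cast_zero, zero_mul]
    exact ModularForm.is_invariant_one A
  | succ n ih =>
    rw [pow_succ, pow_succ, show ((n + 1 : ℕ) : ℤ) * k = n * k + k by push_cast; ring,
      ModularForm.mul_slash_SL2, ih]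

/-- A finite product of nonzero holomorphic functions on `ℍ` is a nonzero (holomorphic) function.
[folklore] -/
theorem prod_ne_zero_of_mdifferentiable {ι : Type*} (s : Finset ι) {f : ι → ℍ → ℂ}
    (hf : ∀ i ∈ s, MDiff (f i)) (hne : ∀ i ∈ s, f i ≠ 0) :
    (∏ i ∈ s, f i) ≠ 0 ∧ MDiff (∏ i ∈ s, f i) := by
  classical
  induction s using Finset.induction_on with
  | empty =>
    refine ⟨?_, ?_⟩
    · simp only [Finset.prod_empty]
      exact one_ne_zero
    · simp only [Finset.prod_empty]
      exact mdifferentiable_const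
  | insert a s ha ih =>
    obtain ⟨ih1, ih2⟩ := ih (fun i hi ↦ hf i (Finset.mem_insert_of_mem hi))
      (fun i hi ↦ hne i (Finset.mem_insert_of_mem hi))
    rw [Finset.prod_insert ha]
    refine ⟨fun h0 ↦ ih1 ?_, (hf a (Finset.mem_insert_self a s)).mul ih2⟩
    exact eq_zero_of_mul_eq_zero_of_mdifferentiable (hf a (Finset.mem_insert_self a s))
      (hne a (Finset.mem_insert_self a s)) ih2.continuous h0

/-- The finite coset space `SL₂(ℤ)/Γ₀(N)` as a `Fintype` (local, from `Finite`), to sum over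
cosets and to use `Fintype.equivFin`. [folklore] -/
local instance : Fintype (SL(2, ℤ) ⧸ Gamma0 N) := Fintype.ofFinite _

/-- `#(SL₂(ℤ)/Γ₀(N)) = μ`. [folklore] -/
theorem card_quotient_eq : Fintype.card (SL(2, ℤ) ⧸ Gamma0 N) = gamma0Index N := by
  rw [← Nat.card_eq_fintype_card, card_coset_eq_gamma0Index]

/-- The explicit weight-`12(μ-1)` forms `G_i = Δ^{μ-1-i} Δ_N^i ∈ M_{12(μ-1)}(Γ₀(N))`. [folklore] -/
def explicitForm (μ : ℕ) (i : Fin μ) : ℍ → ℂ :=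
  ModularForm.discriminant ^ (μ - 1 - (i : ℕ)) * deltaDil N ^ (i : ℕ)

/-- `G_i ∈ A_{12(μ-1)}`. [folklore] -/
theorem explicitForm_mem (μ : ℕ) (i : Fin μ) :
    explicitForm N μ i ∈ gamma0Space N (12 * ((μ : ℤ) - 1)) := by
  have hΔ : ModularForm.discriminant ∈ gamma0Space N 12 :=
    formSpace_mono (gamma0_le_SL N) (coe_mem_formSpace (CuspForm.discriminant : ModularForm 𝒮ℒ 12))
  have h1 := pow_mem_formSpace hΔ (μ - 1 - (i : ℕ))
  have h2 := pow_mem_formSpace (deltaDil_mem N) (i : ℕ)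
  have := mul_mem_formSpace h1 h2
  have hi : (i : ℕ) ≤ μ - 1 := Nat.le_sub_one_of_lt i.2
  rwa [show ((μ - 1 - (i : ℕ) : ℕ) : ℤ) * 12 + ((i : ℕ) : ℤ) * 12 = 12 * ((μ : ℤ) - 1) by
    rw [Nat.cast_sub hi, Nat.cast_sub (by omega)]; ring] at this

/-- **`G_0, …, G_{μ-1}` are independent over `M(SL₂(ℤ))`**: if `∑ p_i Δ^{μ-1-i}Δ_N^i = 0` with
level-one `p_i` of a common weight `w`, then all `p_i = 0`. Proof: slashing by the coset
representatives, `∑_i p_i(τ) u_x(τ)^i = 0` for the `μ` conjugates `u_x = (Δ_N ∣ g⁻¹)/Δ`, which are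
pairwise distinct functions; where their values are distinct the Vandermonde system forces
`p_i(τ) = 0`, and that locus is the complement of the zeros of a nonzero holomorphic function.
[folklore] -/
theorem explicitForm_indep (w : ℤ) (p : Fin (gamma0Index N) → ℍ → ℂ)
    (hp : ∀ i, p i ∈ levelOneSpace w)
    (h0 : ∑ i, p i * explicitForm N (gamma0Index N) i = 0) : ∀ i, p i = 0 := by
  classical
  have hF := slash_eq_of_mem_gamma0Space (deltaDil_mem N)
  -- Step 1: the slashed relations, pointwise
  have hrel : ∀ (x : SL(2, ℤ) ⧸ Gamma0 N) (τ : ℍ), ∑ i : Fin (gamma0Index N), p i τ * (ModularForm.discriminant τ ^ ((gamma0Index N) - 1 - (i : ℕ)) *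
      conjDeltaDil N x τ ^ (i : ℕ)) = 0 := by
    intro x
    induction x using QuotientGroup.induction_on with
    | H g =>
      intro τ
      have h1 := congrArg (fun f : ℍ → ℂ ↦ (f ∣[w + 12 * (((gamma0Index N) : ℤ) - 1)] ((g⁻¹ : SL(2, ℤ)) : GL (Fin 2) ℝ)) τ) h0
      simp only [SlashAction.zero_slash, Pi.zero_apply] at h1
      rw [← h1, ← SL_slash, SlashAction.sum_slash, Finset.sum_apply]
      refine Finset.sum_congr rfl fun i _ ↦ ?_
      have hi : (i : ℕ) ≤ (gamma0Index N) - 1 := Nat.le_sub_one_of_lt i.2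
      have hw : w + 12 * (((gamma0Index N) : ℤ) - 1) = w + ((((gamma0Index N) - 1 - (i : ℕ) : ℕ) : ℤ) * 12 + ((i : ℕ) : ℤ) * 12) := by
        rw [Nat.cast_sub hi, Nat.cast_sub (by omega)]; ring
      rw [hw, explicitForm, ModularForm.mul_slash_SL2, ModularForm.mul_slash_SL2, pow_slash_SL2,
        pow_slash_SL2]
      have hpi : p i ∣[w] (g⁻¹ : SL(2, ℤ)) = p i := by
        obtain ⟨P, hP⟩ := hp i
        rw [← hP, SL_slash]
        exact P.slash_action_eq' _ ⟨g⁻¹, rfl⟩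
      rw [hpi, SL_slash, discriminant_slash, SL_slash, ← cosetSlash_mk hF g]
      rfl
  -- Step 2: where the conjugate values are distinct, `p_i(τ) = 0`
  have hpt : ∀ τ : ℍ, Function.Injective (fun x : SL(2, ℤ) ⧸ Gamma0 N ↦ conjDeltaDil N x τ) → ∀ i, p i τ = 0 := by
    intro τ hinj
    let e : (SL(2, ℤ) ⧸ Gamma0 N) ≃ Fin (gamma0Index N) := Fintype.equivFinOfCardEq (card_quotient_eq N)
    have hΔ : ModularForm.discriminant τ ≠ 0 := discriminant_ne_zero τ
    let f : Fin (gamma0Index N) → ℂ := fun j ↦ conjDeltaDil N (e.symm j) τ / ModularForm.discriminant τ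
    have hf : Function.Injective f := by
      intro j j' h
      have := hinj ((div_left_inj' hΔ).mp h : conjDeltaDil N (e.symm j) τ = conjDeltaDil N (e.symm j') τ)
      exact e.symm.injective this
    have key : (fun i ↦ p i τ) = 0 := by
      refine Matrix.eq_zero_of_forall_index_sum_mul_pow_eq_zero hf fun j ↦ ?_
      have := hrel (e.symm j) τ
      -- divide by `Δ(τ)^{(gamma0Index N)-1}`
      have hterm : ∀ i : Fin (gamma0Index N), p i τ * (ModularForm.discriminant τ ^ ((gamma0Index N) - 1 - (i : ℕ)) *
          conjDeltaDil N (e.symm j) τ ^ (i : ℕ)) =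
          ModularForm.discriminant τ ^ ((gamma0Index N) - 1) * (p i τ * f j ^ (i : ℕ)) := by
        intro i
        have hi : (i : ℕ) ≤ (gamma0Index N) - 1 := Nat.le_sub_one_of_lt i.2
        have hsplit : ModularForm.discriminant τ ^ ((gamma0Index N) - 1) =
            ModularForm.discriminant τ ^ ((gamma0Index N) - 1 - (i : ℕ)) *
              ModularForm.discriminant τ ^ (i : ℕ) := by
          rw [← pow_add, Nat.sub_add_cancel hi]
        simp only [f]
        rw [hsplit, div_pow, div_eq_mul_inv]
        have hu : ModularForm.discriminant τ ^ (i : ℕ) * (ModularForm.discriminant τ ^ (i : ℕ))⁻¹ = 1 :=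
          mul_inv_cancel₀ (pow_ne_zero _ hΔ)
        linear_combination (-(p i τ * ModularForm.discriminant τ ^ ((gamma0Index N) - 1 - (i : ℕ)) *
          conjDeltaDil N (e.symm j) τ ^ (i : ℕ))) * hu
      simp only [hterm, ← Finset.mul_sum] at this
      exact (mul_eq_zero.mp this).resolve_left (pow_ne_zero _ hΔ)
    exact fun i ↦ congrFun key i
  -- Step 3: the distinctness locus is the complement of the zeros of `W ≠ 0`
  set W : ℍ → ℂ := ∏ q ∈ (Finset.univ : Finset ((SL(2, ℤ) ⧸ Gamma0 N) × (SL(2, ℤ) ⧸ Gamma0 N))).filter (fun q ↦ q.1 ≠ q.2),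
    (conjDeltaDil N q.1 - conjDeltaDil N q.2) with hW
  have hWprop := prod_ne_zero_of_mdifferentiable ((Finset.univ : Finset ((SL(2, ℤ) ⧸ Gamma0 N) × (SL(2, ℤ) ⧸ Gamma0 N))).filter (fun q ↦ q.1 ≠ q.2))
    (f := fun q ↦ conjDeltaDil N q.1 - conjDeltaDil N q.2)
    (fun q _ ↦ (mdifferentiable_conjDeltaDil N q.1).sub (mdifferentiable_conjDeltaDil N q.2))
    (fun q hq ↦ by
      rw [Finset.mem_filter] at hq
      exact sub_ne_zero.mpr fun h ↦ hq.2 (conjDeltaDil_injective N h))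
  have hWτ : ∀ τ, W τ ≠ 0 → Function.Injective (fun x : SL(2, ℤ) ⧸ Gamma0 N ↦ conjDeltaDil N x τ) := by
    intro τ hτ x y hxy
    by_contra hne
    apply hτ
    rw [hW, Finset.prod_apply]
    exact Finset.prod_eq_zero (Finset.mem_filter.mpr ⟨Finset.mem_univ (x, y), hne⟩)
      (by simp [hxy])
  intro i
  have : W * p i = 0 := by
    funext τ
    by_cases hτ : W τ = 0
    · simp [hτ]
    · simp [hpt τ (hWτ τ hτ) i]
  exact eq_zero_of_mul_eq_zero_of_mdifferentiable hWprop.2 hWprop.1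
    (mdifferentiable_of_mem_formSpace (hp i)).continuous this

/-- `dim R_w ≤ ⌊w/12⌋ + 1` (Mathlib's level-one dimension formula; `0` for `w < 0` or odd). [folklore] -/
theorem finrank_levelOneSpace_le (w : ℤ) :
    Module.finrank ℂ (levelOneSpace w) ≤ w.toNat / 12 + 1 := by
  rw [finrank_formSpace]
  rcases lt_or_ge w 0 with hneg | hnn
  · have : Module.finrank ℂ (ModularForm 𝒮ℒ w) = 0 :=
      Module.finrank_eq_of_rank_eq (by rw [ModularForm.levelOne_neg_weight_rank_zero hneg]; simp)
    omega
  rcases Int.even_or_odd w with heven | hodd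
  · obtain ⟨n, rfl⟩ : ∃ n : ℕ, w = n := ⟨w.toNat, (Int.toNat_of_nonneg hnn).symm⟩
    have h := ModularForm.dimension_level_one n (by exact_mod_cast heven)
    have : Module.finrank ℂ (ModularForm 𝒮ℒ n) = if n ≡ 2 [MOD 12] then n / 12 else n / 12 + 1 :=
      Module.finrank_eq_of_rank_eq (by rw [h])
    rw [this, Int.toNat_natCast]
    split_ifs <;> omega
  · have : Module.finrank ℂ (ModularForm 𝒮ℒ w) = 0 :=
      Module.finrank_eq_of_rank_eq (by rw [ModularForm.levelOne_odd_weight_rank_zero hodd]; simp)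
    omega

variable {N}

/-- **Dimension of `A_m` from a level-one basis**: `dim A_m = ∑_i dim R_{m - k_i}`. [folklore] -/
theorem IsLevelOneBasis.finrank_eq {r : ℕ} {wt : Fin r → ℤ} {F : Fin r → ℍ → ℂ}
    (hb : IsLevelOneBasis N wt F) (m : ℤ) :
    Module.finrank ℂ (gamma0Space N m) = ∑ i, Module.finrank ℂ (levelOneSpace (m - wt i)) := by
  let Ψ : (Π i, levelOneSpace (m - wt i)) →ₗ[ℂ] (ℍ → ℂ) :=
    { toFun := fun p ↦ ∑ i : Fin r, ((p i : ℍ → ℂ) * F i : ℍ → ℂ)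
      map_add' := fun p p' ↦ by
        simp only [Pi.add_apply, Submodule.coe_add, add_mul, Finset.sum_add_distrib]
      map_smul' := fun c p ↦ by
        simp only [Pi.smul_apply, Submodule.coe_smul, RingHom.id_apply, Finset.smul_sum, smul_mul_assoc] }
  have hmem : ∀ p, Ψ p ∈ gamma0Space N m := fun p ↦ by
    show (∑ i : Fin r, ((p i : ℍ → ℂ) * F i : ℍ → ℂ)) ∈ gamma0Space N m
    refine Submodule.sum_mem _ fun i _ ↦ ?_
    have := levelOne_mul_mem N (p i).2 (hb.mem i)
    rwa [sub_add_cancel] at this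
  have hinj : Function.Injective (Ψ.codRestrict _ hmem) := by
    rw [injective_iff_map_eq_zero]
    intro p hp0
    have hsum0 : ∑ i : Fin r, ((p i : ℍ → ℂ) * F i : ℍ → ℂ) = 0 := congrArg Subtype.val hp0
    have := hb.indep m (fun i ↦ p i) (fun i ↦ (p i).2) hsum0
    funext i
    exact Subtype.ext (this i)
  have hsurj : Function.Surjective (Ψ.codRestrict _ hmem) := by
    rintro ⟨f, hf⟩
    obtain ⟨p, hp, hfp⟩ := hb.span m f hf
    exact ⟨fun i ↦ ⟨p i, hp i⟩, Subtype.ext hfp.symm⟩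
  rw [← (LinearEquiv.ofBijective _ ⟨hinj, hsurj⟩).finrank_eq, Module.finrank_pi_fintype]

variable (N)

/-- **The rank is at least `μ`**: a level-one basis of `M(Γ₀(N))` has at least
`μ = [SL₂(ℤ) : Γ₀(N)]` elements (the `μ` independent forms `Δ^{μ-1-i}Δ_N^i` give
`dim A_{12L+12(μ-1)} ≥ μL`, while `r` generators give `≤ r(L + μ)`). [cite: Gannon2014, Thm. 3.4] -/
theorem IsLevelOneBasis.gamma0Index_le {r : ℕ} {wt : Fin r → ℤ} {F : Fin r → ℍ → ℂ}
    (hb : IsLevelOneBasis N wt F) : gamma0Index N ≤ r := by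
  set μ := gamma0Index N with hμ
  have hμpos : 1 ≤ μ := by
    rw [hμ, ← card_quotient_eq N]
    exact Fintype.card_pos
  -- for every `L`: `μ L ≤ r (L + μ)`
  have key : ∀ L : ℕ, μ * L ≤ r * (L + μ) := by
    intro L
    set m : ℤ := 12 * L + 12 * ((μ : ℤ) - 1) with hm
    -- lower bound from the explicit forms
    let Φ : (Fin μ → levelOneSpace (12 * (L : ℤ))) →ₗ[ℂ] (ℍ → ℂ) :=
      { toFun := fun p ↦ ∑ i : Fin μ, ((p i : ℍ → ℂ) * explicitForm N μ i : ℍ → ℂ)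
        map_add' := fun p p' ↦ by
          simp only [Pi.add_apply, Submodule.coe_add, add_mul, Finset.sum_add_distrib]
        map_smul' := fun c p ↦ by
          simp only [Pi.smul_apply, Submodule.coe_smul, RingHom.id_apply, Finset.smul_sum, smul_mul_assoc] }
    have hΦmem : ∀ p, Φ p ∈ gamma0Space N m := fun p ↦ by
      show (∑ i : Fin μ, ((p i : ℍ → ℂ) * explicitForm N μ i : ℍ → ℂ)) ∈ gamma0Space N m
      refine Submodule.sum_mem _ fun i _ ↦ ?_
      have := levelOne_mul_mem N (p i).2 (explicitForm_mem N μ i)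
      rwa [show 12 * (L : ℤ) + 12 * ((μ : ℤ) - 1) = m by rw [hm]] at this
    have hΦinj : Function.Injective (Φ.codRestrict _ hΦmem) := by
      rw [injective_iff_map_eq_zero]
      intro p hp0
      have hsum0 : ∑ i : Fin μ, ((p i : ℍ → ℂ) * explicitForm N μ i : ℍ → ℂ) = 0 :=
        congrArg Subtype.val hp0
      have := explicitForm_indep N (12 * (L : ℤ)) (fun i ↦ p i) (fun i ↦ (p i).2) hsum0
      funext i
      exact Subtype.ext (this i)
    have hlow : μ * L ≤ Module.finrank ℂ (gamma0Space N m) := by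
      refine le_trans ?_ (LinearMap.finrank_le_finrank_of_injective hΦinj)
      rw [Module.finrank_pi_fintype, Finset.sum_const, Finset.card_univ, Fintype.card_fin, smul_eq_mul]
      refine Nat.mul_le_mul_left μ ?_
      have := le_finrank_levelOneSpace (w := 12 * L) ⟨6 * L, by ring⟩
      rw [show ((12 * L : ℕ) : ℤ) = 12 * (L : ℤ) by push_cast; ring] at this
      omega
    -- upper bound from the basis
    have hup : Module.finrank ℂ (gamma0Space N m) ≤ r * (L + μ) := by
      rw [hb.finrank_eq m]
      refine le_trans (Finset.sum_le_sum fun i _ ↦ finrank_levelOneSpace_le (m - wt i)) ?_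
      refine le_trans (Finset.sum_le_sum (g := fun _ ↦ L + μ) fun i _ ↦ ?_) ?_
      · have : (m - wt i).toNat ≤ 12 * L + 12 * (μ - 1) := by
          have h0 := hb.mem i
          rcases lt_or_ge (wt i) 0 with hneg | hnn
          · have : gamma0Space N (wt i) = ⊥ := formSpace_eq_bot_of_neg hneg
            -- weights of basis elements may be negative only if `F i = 0`, impossible by independence
            exfalso
            rw [this, Submodule.mem_bot] at h0
            have := hb.indep (wt i) (fun j ↦ if j = i then 1 else 0) (fun j ↦ by
              split_ifs with hj
              · subst hj; rw [sub_self]; exact ⟨1, ModularForm.one_coe_eq_one⟩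
              · exact Submodule.zero_mem _) (by simp [h0]) i
            simp at this
          · rw [hm]
            omega
        have h12 : (12 * L + 12 * (μ - 1)) / 12 + 1 ≤ L + μ := by omega
        exact le_trans (Nat.add_le_add_right (Nat.div_le_div_right this) 1) h12
      · simp
    exact hlow.trans hup
  by_contra hlt
  push Not at hlt
  have h1 := key (r * μ + 1)
  have h2 : (r : ℤ) + 1 ≤ μ := by exact_mod_cast hlt
  have h3 : ((μ : ℤ) - r - 1) * (r * μ + 1) ≥ 0 := mul_nonneg (by linarith) (by positivity)
  zify at h1
  nlinarith

/-- **`rank = μ`**: combined with `r ≤ μ` of `exists_isLevelOneBasis`. [cite: Gannon2014, Thm. 3.4] -/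
theorem exists_isLevelOneBasis_card_eq : ∃ (wt : Fin (gamma0Index N) → ℤ) (F : Fin (gamma0Index N) → ℍ → ℂ),
    IsLevelOneBasis N wt F ∧ ∀ i, 0 ≤ wt i ∧ Even (wt i) := by
  obtain ⟨r, wt, F, hb, hle, hwt⟩ := exists_isLevelOneBasis N
  have hr : r = gamma0Index N := le_antisymm hle (hb.gamma0Index_le N)
  subst hr
  exact ⟨wt, F, hb, hwt⟩

end Rank

/-! ### Calculus of `D = (2πi)⁻¹ d/dτ`: finite sums, products, determinants -/

section DCalculus

open Derivative

/-- Holomorphy of finite sums. [folklore] -/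
theorem mdifferentiable_finset_sum {ι : Type*} (s : Finset ι) {f : ι → ℍ → ℂ}
    (hf : ∀ i ∈ s, MDiff (f i)) : MDiff (∑ i ∈ s, f i) := by
  classical
  induction s using Finset.induction_on with
  | empty => simp only [Finset.sum_empty]; exact mdifferentiable_const
  | insert a s ha ih =>
    rw [Finset.sum_insert ha]
    exact (hf a (Finset.mem_insert_self a s)).add (ih fun i hi ↦ hf i (Finset.mem_insert_of_mem hi))

/-- `D` of a finite sum. [folklore] -/
theorem normalizedDeriv_finset_sum {ι : Type*} (s : Finset ι) {f : ι → ℍ → ℂ}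
    (hf : ∀ i ∈ s, MDiff (f i)) :
    D (∑ i ∈ s, f i) = ∑ i ∈ s, D (f i) := by
  classical
  induction s using Finset.induction_on with
  | empty =>
    simp only [Finset.sum_empty]
    exact normalizedDerivOfComplex_const 0
  | insert a s ha ih =>
    have hfs : ∀ i ∈ s, MDiff (f i) := fun i hi ↦ hf i (Finset.mem_insert_of_mem hi)
    rw [Finset.sum_insert ha, Finset.sum_insert ha,
      normalizedDerivOfComplex_add (f a) (∑ i ∈ s, f i) (hf a (Finset.mem_insert_self a s))
        (mdifferentiable_finset_sum s hfs), ih hfs]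

/-- Holomorphy of finite products. [folklore] -/
theorem mdifferentiable_finset_prod {ι : Type*} (s : Finset ι) {f : ι → ℍ → ℂ}
    (hf : ∀ i ∈ s, MDiff (f i)) : MDiff (∏ i ∈ s, f i) := by
  classical
  induction s using Finset.induction_on with
  | empty => simp only [Finset.prod_empty]; exact mdifferentiable_const
  | insert a s ha ih =>
    rw [Finset.prod_insert ha]
    exact (hf a (Finset.mem_insert_self a s)).mul (ih fun i hi ↦ hf i (Finset.mem_insert_of_mem hi))

/-- **Leibniz rule** for `D` on finite products:
`D(∏ f_i) = ∑_i (∏_{j ≠ i} f_j) · D f_i`. [folklore] -/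
theorem normalizedDeriv_finset_prod {ι : Type*} [DecidableEq ι] (s : Finset ι) {f : ι → ℍ → ℂ}
    (hf : ∀ i ∈ s, MDiff (f i)) :
    D (∏ i ∈ s, f i) = ∑ i ∈ s, (∏ j ∈ s.erase i, f j) * D (f i) := by
  induction s using Finset.induction_on with
  | empty =>
    simp only [Finset.prod_empty, Finset.sum_empty]
    exact normalizedDerivOfComplex_const 1
  | insert a s ha ih =>
    have hfa := hf a (Finset.mem_insert_self a s)
    have hfs : ∀ i ∈ s, MDiff (f i) := fun i hi ↦ hf i (Finset.mem_insert_of_mem hi)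
    rw [Finset.prod_insert ha, normalizedDerivOfComplex_mul _ _ hfa (mdifferentiable_finset_prod s hfs),
      ih hfs, Finset.sum_insert ha, Finset.erase_insert ha, Finset.mul_sum]
    congr 1
    · ring
    · refine Finset.sum_congr rfl fun i hi ↦ ?_
      have hia : i ≠ a := fun h ↦ ha (h ▸ hi)
      rw [Finset.erase_insert_of_ne hia.symm, Finset.prod_insert (fun h ↦ ha (Finset.mem_of_mem_erase h))]
      ring

/-- **`D` of a determinant** of holomorphic functions: the sum over columns of the determinants with
that column differentiated. [folklore] -/
theorem normalizedDeriv_det {n : Type*} [Fintype n] [DecidableEq n] (M : ℍ → Matrix n n ℂ)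
    (hM : ∀ a j, MDiff (fun τ ↦ M τ a j)) :
    D (fun τ ↦ (M τ).det) =
      fun τ ↦ ∑ j, ((M τ).updateCol j (fun a ↦ D (fun τ ↦ M τ a j) τ)).det := by
  -- write both sides with the Leibniz formula
  have hL : (fun τ ↦ (M τ).det) = ∑ σ : Equiv.Perm n,
      (fun τ ↦ ((Equiv.Perm.sign σ : ℤ) : ℂ)) * ∏ i, (fun τ ↦ M τ (σ i) i) := by
    funext τ
    rw [Matrix.det_apply']
    simp only [Finset.sum_apply, Pi.mul_apply, Finset.prod_apply]
  have hprodD : ∀ σ : Equiv.Perm n, MDiff (∏ i, fun τ ↦ M τ (σ i) i) := fun σ ↦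
    mdifferentiable_finset_prod _ fun i _ ↦ hM _ _
  rw [hL, normalizedDeriv_finset_sum _ (fun σ _ ↦ mdifferentiable_const.mul (hprodD σ))]
  funext τ
  simp only [Finset.sum_apply]
  -- RHS: expand each determinant
  have hR : ∀ j, ((M τ).updateCol j (fun a ↦ D (fun τ ↦ M τ a j) τ)).det =
      ∑ σ : Equiv.Perm n, ((Equiv.Perm.sign σ : ℤ) : ℂ) *
        ((∏ i ∈ Finset.univ.erase j, M τ (σ i) i) * D (fun τ ↦ M τ (σ j) j) τ) := by
    intro j
    rw [Matrix.det_apply']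
    refine Finset.sum_congr rfl fun σ _ ↦ ?_
    congr 1
    rw [← Finset.mul_prod_erase _ _ (Finset.mem_univ j), Matrix.updateCol_self, mul_comm]
    congr 1
    exact Finset.prod_congr rfl fun i hi ↦ by
      rw [Matrix.updateCol_ne (Finset.ne_of_mem_erase hi)]
  simp only [hR]
  rw [Finset.sum_comm]
  refine Finset.sum_congr rfl fun σ _ ↦ ?_
  rw [normalizedDerivOfComplex_mul _ _ mdifferentiable_const (hprodD σ), normalizedDerivOfComplex_const,
    normalizedDeriv_finset_prod _ (fun i _ ↦ hM _ _)]
  simp only [Pi.add_apply, Pi.mul_apply, Pi.zero_apply, zero_mul, zero_add, Finset.sum_apply,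
    Finset.prod_apply, Finset.mul_sum]

end DCalculus

/-! ### The Serre derivative preserves `M(Γ₀(N))` -/

section Serre

open Derivative

variable (N : ℕ) [NeZero N]

omit [NeZero N] in
/-- `Γ(N) ≤ Γ₀(N)`. [folklore] -/
theorem Gamma_le_Gamma0 : CongruenceSubgroup.Gamma N ≤ Gamma0 N := by
  intro γ hγ
  rw [CongruenceSubgroup.Gamma_mem] at hγ
  rw [Gamma0_mem]
  exact hγ.2.2.1

/-- Invariance under `Tⁿ` gives `n`-periodicity of `G ∘ ofComplex`. [folklore] -/
theorem periodic_comp_ofComplex_of_slash_T_zpow {G : ℍ → ℂ} {k : ℤ} {n : ℤ}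
    (h : G ∣[k] ((ModularGroup.T ^ n : SL(2, ℤ)) : GL (Fin 2) ℝ) = G) :
    Function.Periodic (G ∘ ofComplex) n := by
  intro z
  by_cases hz : 0 < z.im
  · have hz' : 0 < (z + n).im := by simpa using hz
    simp only [Function.comp_apply]
    rw [ofComplex_apply_of_im_pos hz', ofComplex_apply_of_im_pos hz]
    have := congrFun h ⟨z, hz⟩
    rw [← ModularForm.SL_slash, ModularForm.SL_slash_apply, UpperHalfPlane.modular_T_zpow_smul] at this
    have hden : denom (ModularGroup.T ^ n : SL(2, ℤ)) (⟨z, hz⟩ : ℍ) = 1 := by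
      rw [ModularGroup.denom_apply]
      simp [ModularGroup.coe_T_zpow]
    rw [hden, one_zpow, mul_one] at this
    rw [← this]
    congr 1
    apply UpperHalfPlane.ext
    simp [UpperHalfPlane.coe_vadd, add_comm]
  · push Not at hz
    simp only [Function.comp_apply]
    rw [ofComplex_apply_eq_of_im_nonpos (by simpa using hz) hz]

omit [NeZero N] in
/-- A `Γ₀(N)`-invariant function translated by `g ∈ SL₂(ℤ)` is invariant under `Tᴺ`
(`g Tᴺ g⁻¹ ∈ Γ(N) ≤ Γ₀(N)`). [folklore] -/
theorem slash_slash_T_pow {G : ℍ → ℂ} {k : ℤ} (hG : ∀ γ ∈ Gamma0 N, G ∣[k] (γ : GL (Fin 2) ℝ) = G)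
    (g : SL(2, ℤ)) :
    (G ∣[k] (g : GL (Fin 2) ℝ)) ∣[k] ((ModularGroup.T ^ (N : ℤ) : SL(2, ℤ)) : GL (Fin 2) ℝ) =
      G ∣[k] (g : GL (Fin 2) ℝ) := by
  have hT : (ModularGroup.T ^ (N : ℤ) : SL(2, ℤ)) ∈ CongruenceSubgroup.Gamma N := by
    have := ModularGroup_T_pow_mem_Gamma (N : ℤ) (N : ℤ) dvd_rfl
    rwa [Int.natAbs_natCast] at this
  have hconj : g * ModularGroup.T ^ (N : ℤ) * g⁻¹ ∈ Gamma0 N :=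
    Gamma_le_Gamma0 N ((CongruenceSubgroup.Gamma_normal N).conj_mem _ hT g)
  rw [← SlashAction.slash_mul, ← coeGL_mul,
    show g * ModularGroup.T ^ (N : ℤ) = (g * ModularGroup.T ^ (N : ℤ) * g⁻¹) * g by group,
    coeGL_mul, SlashAction.slash_mul, hG _ hconj]

omit [NeZero N] in
/-- Periodicity (period `N`) of the translates of members of `A_k`. [folklore] -/
theorem periodic_slash_of_mem {k : ℤ} {G : ℍ → ℂ} (hG : G ∈ gamma0Space N k) (g : SL(2, ℤ)) :
    Function.Periodic ((G ∣[k] (g : GL (Fin 2) ℝ)) ∘ ofComplex) (N : ℤ) :=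
  periodic_comp_ofComplex_of_slash_T_zpow (slash_slash_T_pow N (slash_eq_of_mem_gamma0Space hG) g)

/-- **The Serre derivative preserves `M_k(Γ₀(N))`**: `ϑ_k f = D f - (k/12)E₂ f ∈ M_{k+2}(Γ₀(N))`
for `f ∈ M_k(Γ₀(N))` (equivariance is Mathlib's `serreDerivative_slash_equivariant`; at each cusp,
`ϑ(f ∣ g) = D(f ∣ g) - (k/12)E₂·(f ∣ g)` is bounded because `D` of a bounded holomorphic periodic
function tends to `0`, `ModularFormsRamanujan.isZeroAtImInfty_normalizedDeriv`). [folklore] -/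
theorem serreDerivative_mem {k : ℤ} {f : ℍ → ℂ} (hf : f ∈ gamma0Space N k) :
    serreDerivative k f ∈ gamma0Space N (k + 2) := by
  have hhol := mdifferentiable_of_mem_formSpace hf
  have hinv := slash_eq_of_mem_gamma0Space hf
  rw [mem_formSpace_iff]
  refine ⟨serreDerivative_mdifferentiable _ hhol, ?_, fun g ↦ ?_⟩
  · rintro _ ⟨γ, hγ, rfl⟩
    have := serreDerivative_slash_invariant (k := k) hhol (γ := γ) (hinv γ hγ)
    rw [ModularForm.SL_slash] at this
    exact this
  · have heq := serreDerivative_slash_equivariant (k := k) hhol (γ := g)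
    rw [ModularForm.SL_slash, ModularForm.SL_slash] at heq
    rw [heq]
    set G := f ∣[k] (g : GL (Fin 2) ℝ) with hGdef
    have hGhol : MDiff G := hhol.slash _ _
    have hGbdd : IsBoundedAtImInfty G := isBoundedAtImInfty_slash_of_mem_formSpace hf g
    have hD : IsBoundedAtImInfty (D G) :=
      (isZeroAtImInfty_normalizedDeriv (h := (N : ℤ)) (by exact_mod_cast NeZero.pos N)
        (by exact_mod_cast periodic_slash_of_mem N hf g) hGhol hGbdd).boundedAtFilter
    have h2 : IsBoundedAtImInfty (fun τ ↦ (k : ℂ) * 12⁻¹ * E2 τ * G τ) := by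
      have := (isBoundedAtImInfty_E2.mul hGbdd).const_mul_left ((k : ℂ) * 12⁻¹)
      refine this.congr_left fun τ ↦ ?_
      simp only [Pi.mul_apply]
      ring
    have hs : serreDerivative k G = fun z ↦ D G z - k * 12⁻¹ * E2 z * G z := rfl
    rw [hs]
    exact hD.sub h2

end Serre

/-! ### The basis-conjugate matrix `Φ`, its determinant `𝒟`, and `ϑ 𝒟 = 0` -/

section Determinant

open Derivative

variable (N : ℕ) [NeZero N]

/-- The finite coset space `SL₂(ℤ)/Γ₀(N)` as a `Fintype` (local, from `Finite`), to sum over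
cosets and to use `Fintype.equivFin`. [folklore] -/
local instance : Fintype (SL(2, ℤ) ⧸ Gamma0 N) := Fintype.ofFinite _

/-- The enumeration `SL₂(ℤ)/Γ₀(N) ≃ Fin μ`. [folklore] -/
def cosetEquiv : (SL(2, ℤ) ⧸ Gamma0 N) ≃ Fin (gamma0Index N) :=
  Fintype.equivFinOfCardEq (card_quotient_eq N)

variable (wt : Fin (gamma0Index N) → ℤ) (F : Fin (gamma0Index N) → ℍ → ℂ)

/-- The **basis-conjugate matrix** `Φ(τ)_{a,j} = (F_j ∣ g_a⁻¹)(τ)` over the cosets `g_aΓ₀(N)`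
and the generators `F_j` (Gannon's fundamental matrix `Ξ` for `ρ = Ind 1`). [cite: Gannon2014, Thm. 3.4] -/
def basisMatrix (τ : ℍ) : Matrix (Fin (gamma0Index N)) (Fin (gamma0Index N)) ℂ :=
  fun a j ↦ cosetSlash N (wt j) (F j) ((cosetEquiv N).symm a) τ

/-- The determinant `𝒟(τ) = det Φ(τ)`. [cite: Gannon2014, Thm. 3.4] -/
def basisDet (τ : ℍ) : ℂ := (basisMatrix N wt F τ).det

/-- The total weight `K = ∑ k_j`. [folklore] -/
def totalWeight : ℤ := ∑ j, wt j

variable {N wt F}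

/-- Entries of `Φ` are holomorphic. [folklore] -/
theorem mdifferentiable_basisMatrix (hb : IsLevelOneBasis N wt F) (a j : Fin (gamma0Index N)) :
    MDiff (fun τ ↦ basisMatrix N wt F τ a j) :=
  mdifferentiable_cosetSlash (hb.mem j) _

/-- `𝒟` is holomorphic. [folklore] -/
theorem mdifferentiable_basisDet (hb : IsLevelOneBasis N wt F) : MDiff (basisDet N wt F) := by
  have : basisDet N wt F = ∑ σ : Equiv.Perm (Fin (gamma0Index N)),
      (fun _ ↦ ((Equiv.Perm.sign σ : ℤ) : ℂ)) * ∏ i, (fun τ ↦ basisMatrix N wt F τ (σ i) i) := by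
    funext τ
    rw [basisDet, Matrix.det_apply']
    simp only [Finset.sum_apply, Pi.mul_apply, Finset.prod_apply]
  rw [this]
  exact mdifferentiable_finset_sum _ fun σ _ ↦ mdifferentiable_const.mul
    (mdifferentiable_finset_prod _ fun i _ ↦ mdifferentiable_basisMatrix hb _ _)

/-- **The connection matrix**: `ϑ_{k_j} F_j = ∑_l P_{lj} F_l` with level-one `P_{lj} ∈ R_{k_j+2-k_l}`;
in particular `P_{jj} ∈ R₂ = 0`. [cite: Gannon2014, Thm. 3.3(b)] -/
theorem exists_connection (hb : IsLevelOneBasis N wt F) :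
    ∃ P : Fin (gamma0Index N) → Fin (gamma0Index N) → ℍ → ℂ,
      (∀ l j, P l j ∈ levelOneSpace (wt j + 2 - wt l)) ∧ (∀ j, P j j = 0) ∧
      ∀ j, serreDerivative (wt j) (F j) = ∑ l, P l j * F l := by
  have h := fun j ↦ hb.span (wt j + 2) _ (serreDerivative_mem N (hb.mem j))
  choose p hp hsum using h
  refine ⟨fun l j ↦ p j l, fun l j ↦ hp j l, fun j ↦ ?_, fun j ↦ hsum j⟩
  have := hp j j
  rw [show wt j + 2 - wt j = 2 by ring] at this
  obtain ⟨Q, hQ⟩ := this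
  show p j j = 0
  rw [← hQ, rank_zero_iff_forall_zero.mp ModularForm.levelOne_weight_two_rank_zero Q]
  rfl

/-- **The derivative of the entries of `Φ`**: `D Φ_{a,j} = ∑_l P_{lj} Φ_{a,l} + (k_j/12) E₂ Φ_{a,j}`
(Serre derivative equivariance under `g_a⁻¹`, level-one invariance of `P`). [folklore] -/
theorem normalizedDeriv_basisMatrix (hb : IsLevelOneBasis N wt F)
    {P : Fin (gamma0Index N) → Fin (gamma0Index N) → ℍ → ℂ}
    (hP : ∀ l j, P l j ∈ levelOneSpace (wt j + 2 - wt l))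
    (hPF : ∀ j, serreDerivative (wt j) (F j) = ∑ l, P l j * F l) (a j : Fin (gamma0Index N)) (τ : ℍ) :
    D (fun τ ↦ basisMatrix N wt F τ a j) τ =
      ∑ l, P l j τ * basisMatrix N wt F τ a l + (wt j : ℂ) * 12⁻¹ * E2 τ * basisMatrix N wt F τ a j := by
  set x := (cosetEquiv N).symm a with hx
  set g : SL(2, ℤ) := x.out with hg
  have hFj := mdifferentiable_of_mem_formSpace (hb.mem j)
  -- the entry as a slash
  have hentry : ∀ l, (fun τ ↦ basisMatrix N wt F τ a l) = F l ∣[wt l] ((g⁻¹ : SL(2, ℤ)) : GL (Fin 2) ℝ) := by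
    intro l
    rfl
  rw [hentry j]
  -- `D (F ∣ g⁻¹) = ϑ (F ∣ g⁻¹) + (k/12) E₂ (F ∣ g⁻¹)` and `ϑ (F ∣ g⁻¹) = (ϑ F) ∣ g⁻¹`
  have h1 : D (F j ∣[wt j] ((g⁻¹ : SL(2, ℤ)) : GL (Fin 2) ℝ)) τ =
      serreDerivative (wt j) (F j ∣[wt j] ((g⁻¹ : SL(2, ℤ)) : GL (Fin 2) ℝ)) τ +
        (wt j : ℂ) * 12⁻¹ * E2 τ * (F j ∣[wt j] ((g⁻¹ : SL(2, ℤ)) : GL (Fin 2) ℝ)) τ := by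
    rw [serreDerivative_apply]
    ring
  have h2 : serreDerivative (wt j) (F j ∣[wt j] ((g⁻¹ : SL(2, ℤ)) : GL (Fin 2) ℝ)) =
      (∑ l, P l j * F l) ∣[wt j + 2] ((g⁻¹ : SL(2, ℤ)) : GL (Fin 2) ℝ) := by
    have := serreDerivative_slash_equivariant (k := wt j) hFj (γ := g⁻¹)
    rw [ModularForm.SL_slash, ModularForm.SL_slash] at this
    rw [← this, hPF j]
  rw [h1, h2, SlashAction.sum_slash, Finset.sum_apply]
  congr 1
  refine Finset.sum_congr rfl fun l _ ↦ ?_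
  rw [show wt j + 2 = (wt j + 2 - wt l) + wt l by ring, ← ModularForm.SL_slash,
    ModularForm.mul_slash_SL2]
  have hPl : P l j ∣[wt j + 2 - wt l] (g⁻¹ : SL(2, ℤ)) = P l j := by
    obtain ⟨Q, hQ⟩ := hP l j
    rw [← hQ, ModularForm.SL_slash]
    exact Q.slash_action_eq' _ ⟨g⁻¹, rfl⟩
  rw [hPl]
  rfl

/-- **`ϑ_K 𝒟 = 0`**, i.e. `D 𝒟 = (K/12) E₂ 𝒟`: by the derivative of a determinant column by column,
each column derivative is `∑_l P_{lj}·(column l) + (k_j/12)E₂·(column j)`, contributing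
`(P_{jj} + k_jE₂/12) 𝒟 = (k_j/12)E₂𝒟` (`P_{jj} ∈ M₂(SL₂(ℤ)) = 0`). [cite: Gannon2014, Thm. 3.4(b)] -/
theorem normalizedDeriv_basisDet (hb : IsLevelOneBasis N wt F) (τ : ℍ) :
    D (basisDet N wt F) τ = (totalWeight N wt : ℂ) * 12⁻¹ * E2 τ * basisDet N wt F τ := by
  obtain ⟨P, hP, hPdiag, hPF⟩ := exists_connection hb
  have hD := congrFun (normalizedDeriv_det (basisMatrix N wt F) (mdifferentiable_basisMatrix hb)) τ
  change D (basisDet N wt F) τ = _ at hD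
  rw [hD]
  have hcol : ∀ j, ((basisMatrix N wt F τ).updateCol j fun a ↦ D (fun τ ↦ basisMatrix N wt F τ a j) τ).det =
      (P j j τ + (wt j : ℂ) * 12⁻¹ * E2 τ) * (basisMatrix N wt F τ).det := by
    intro j
    have := Matrix.det_updateCol_sum (basisMatrix N wt F τ) j
      (fun l ↦ P l j τ + if l = j then (wt j : ℂ) * 12⁻¹ * E2 τ else 0)
    have hfun : (fun a ↦ D (fun τ ↦ basisMatrix N wt F τ a j) τ) =
        fun k ↦ ∑ x, (P x j τ + if x = j then (wt j : ℂ) * 12⁻¹ * E2 τ else 0) • basisMatrix N wt F τ k x := by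
      funext a
      rw [normalizedDeriv_basisMatrix hb hP hPF a j τ]
      simp only [smul_eq_mul, add_mul, Finset.sum_add_distrib, ite_mul, zero_mul, Finset.sum_ite_eq',
        Finset.mem_univ, if_true]
    rw [hfun, this, smul_eq_mul]
    simp
  simp only [hcol, hPdiag, Pi.zero_apply, zero_add, ← Finset.sum_mul]
  rw [basisDet, totalWeight]
  push_cast
  simp only [Finset.sum_mul]

/-- **`𝒟¹² = c · Δ^K` on `ℍ`** (`K = ∑ k_j ≥ 0`): both sides solve `D y = K E₂ y`
(`D Δ = E₂ Δ`, Ramanujan), so their ratio has zero derivative on the connected `ℍ`.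
[cite: Gannon2014, Thm. 3.4(b)] -/
theorem exists_basisDet_pow_eq (hb : IsLevelOneBasis N wt F) (hK : 0 ≤ totalWeight N wt) :
    ∃ c : ℂ, ∀ τ, basisDet N wt F τ ^ 12 = c * ModularForm.discriminant τ ^ (totalWeight N wt).toNat := by
  set K := (totalWeight N wt).toNat with hKdef
  have hKc : ((totalWeight N wt : ℤ) : ℂ) = (K : ℂ) := by
    rw [hKdef, show ((totalWeight N wt).toNat : ℂ) = (((totalWeight N wt).toNat : ℤ) : ℂ) by norm_cast,
      Int.toNat_of_nonneg hK]
  set G : ℍ → ℂ := basisDet N wt F ^ 12 with hG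
  set H : ℍ → ℂ := ModularForm.discriminant ^ K with hH
  have hGhol : MDiff G := (mdifferentiable_basisDet hb).pow 12
  have hΔhol : MDiff ModularForm.discriminant := CuspForm.discriminant.holo'
  have hHhol : MDiff H := hΔhol.pow K
  have hDG : ∀ τ, D G τ = (K : ℂ) * E2 τ * G τ := by
    intro τ
    rw [hG, normalizedDerivOfComplex_pow _ _ (mdifferentiable_basisDet hb)]
    simp only [Pi.mul_apply, Pi.pow_apply, Pi.natCast_def]
    rw [normalizedDeriv_basisDet hb τ, hKc]
    have : basisDet N wt F τ ^ 12 = basisDet N wt F τ ^ (12 - 1) * basisDet N wt F τ := by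
      rw [← pow_succ]
    rw [this]
    push_cast
    ring
  have hDH : ∀ τ, D H τ = (K : ℂ) * E2 τ * H τ := by
    intro τ
    rw [hH, normalizedDerivOfComplex_pow _ _ hΔhol]
    simp only [Pi.mul_apply, Pi.pow_apply, Pi.natCast_def]
    rw [normalizedDeriv_discriminant τ]
    rcases Nat.eq_zero_or_pos K with hK0 | hKpos
    · simp [hK0]
    · have : ModularForm.discriminant τ ^ K = ModularForm.discriminant τ ^ (K - 1) * ModularForm.discriminant τ := by
        rw [← pow_succ, Nat.sub_add_cancel hKpos]
      rw [this]
      ring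
  have hH0 : ∀ τ, H τ ≠ 0 := fun τ ↦ pow_ne_zero _ (discriminant_ne_zero τ)
  -- the ratio has zero derivative on the upper half-plane
  let R : ℂ → ℂ := fun z ↦ (G ∘ ofComplex) z / (H ∘ ofComplex) z
  have hRderiv : ∀ z : ℂ, 0 < z.im → HasDerivAt R 0 z := by
    intro z hz
    have hGz := (UpperHalfPlane.mdifferentiableAt_iff.mp (hGhol ⟨z, hz⟩)).hasDerivAt
    have hHz := (UpperHalfPlane.mdifferentiableAt_iff.mp (hHhol ⟨z, hz⟩)).hasDerivAt
    have hH0z : (H ∘ ofComplex) z ≠ 0 := by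
      simp only [Function.comp_apply, ofComplex_apply_of_im_pos hz]
      exact hH0 _
    refine (hGz.div hHz hH0z).congr_deriv ?_
    -- numerator vanishes: `G' H - G H' = 2πi (D G · H - G · D H) = 0`
    have eG : deriv (G ∘ ofComplex) z = 2 * π * I * D G ⟨z, hz⟩ := by
      have : D G ⟨z, hz⟩ = (2 * π * I)⁻¹ * deriv (G ∘ ofComplex) z := rfl
      rw [this, ← mul_assoc, mul_inv_cancel₀ Complex.two_pi_I_ne_zero, one_mul]
    have eH : deriv (H ∘ ofComplex) z = 2 * π * I * D H ⟨z, hz⟩ := by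
      have : D H ⟨z, hz⟩ = (2 * π * I)⁻¹ * deriv (H ∘ ofComplex) z := rfl
      rw [this, ← mul_assoc, mul_inv_cancel₀ Complex.two_pi_I_ne_zero, one_mul]
    have hdG : deriv (G ∘ ofComplex) (⟨z, hz⟩ : ℍ) = deriv (G ∘ ofComplex) z := rfl
    have hdH : deriv (H ∘ ofComplex) (⟨z, hz⟩ : ℍ) = deriv (H ∘ ofComplex) z := rfl
    rw [hdG, hdH, eG, eH, hDG, hDH]
    simp only [Function.comp_apply, ofComplex_apply_of_im_pos hz]
    ring
  have hRconst : ∀ z w : ℂ, 0 < z.im → 0 < w.im → R z = R w := by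
    intro z w hz hw
    have hdiff : DifferentiableOn ℂ R {z : ℂ | 0 < z.im} := fun z hz ↦
      (hRderiv z hz).differentiableAt.differentiableWithinAt
    refine (convex_halfSpace_im_gt 0).is_const_of_fderivWithin_eq_zero hdiff ?_ hz hw
    intro u hu
    rw [fderivWithin_of_isOpen isOpen_upperHalfPlaneSet hu, (hRderiv u hu).hasFDerivAt.fderiv]
    ext
    simp
  refine ⟨R (UpperHalfPlane.I : ℂ), fun τ ↦ ?_⟩
  have := hRconst τ UpperHalfPlane.I τ.im_pos UpperHalfPlane.I.im_pos
  have hRτ : R τ = G τ / H τ := by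
    simp only [R, Function.comp_apply, ofComplex_apply]
  rw [← this, hRτ, show ModularForm.discriminant τ ^ K = H τ from rfl, div_mul_cancel₀ _ (hH0 τ)]
  rfl

/-- Slashing a level-one combination: `(∑ p_i G_i) ∣ₘ g = ∑ p_i (G_i ∣_{k_i} g)` for level-one
`p_i` of weight `m - k_i`. [folklore] -/
theorem sum_mul_slash_of_levelOne {ι : Type*} (s : Finset ι) {m : ℤ} {k : ι → ℤ} {p G : ι → ℍ → ℂ}
    (hp : ∀ i ∈ s, p i ∈ levelOneSpace (m - k i)) (g : SL(2, ℤ)) :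
    (∑ i ∈ s, p i * G i) ∣[m] (g : GL (Fin 2) ℝ) = ∑ i ∈ s, p i * (G i ∣[k i] (g : GL (Fin 2) ℝ)) := by
  rw [SlashAction.sum_slash]
  refine Finset.sum_congr rfl fun i hi ↦ ?_
  rw [show m = (m - k i) + k i by ring, ← ModularForm.SL_slash, ModularForm.mul_slash_SL2]
  obtain ⟨Q, hQ⟩ := hp i hi
  have : p i ∣[m - k i] g = p i := by
    rw [← hQ, ModularForm.SL_slash]
    exact Q.slash_action_eq' _ ⟨g, rfl⟩
  rw [this]
  rfl

/-- **`𝒟 ≢ 0`**: at a point where the `μ` conjugates of `Δ_N` take distinct values, the matrix of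
conjugates of the explicit forms `Δ^{μ-1-i}Δ_N^i` (a column-scaled Vandermonde matrix) is
invertible, and it factors as `Φ · Q` through the basis. [folklore] -/
theorem exists_basisDet_ne_zero (hb : IsLevelOneBasis N wt F) : ∃ τ, basisDet N wt F τ ≠ 0 := by
  classical
  -- a point where the conjugate values are pairwise distinct
  set W : ℍ → ℂ := ∏ q ∈ (Finset.univ : Finset ((SL(2, ℤ) ⧸ Gamma0 N) × (SL(2, ℤ) ⧸ Gamma0 N))).filter
    (fun q ↦ q.1 ≠ q.2), (conjDeltaDil N q.1 - conjDeltaDil N q.2) with hW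
  have hWprop := prod_ne_zero_of_mdifferentiable
    ((Finset.univ : Finset ((SL(2, ℤ) ⧸ Gamma0 N) × (SL(2, ℤ) ⧸ Gamma0 N))).filter (fun q ↦ q.1 ≠ q.2))
    (f := fun q ↦ conjDeltaDil N q.1 - conjDeltaDil N q.2)
    (fun q _ ↦ (mdifferentiable_conjDeltaDil N q.1).sub (mdifferentiable_conjDeltaDil N q.2))
    (fun q hq ↦ by
      rw [Finset.mem_filter] at hq
      exact sub_ne_zero.mpr fun h ↦ hq.2 (conjDeltaDil_injective N h))
  obtain ⟨τ, hτ⟩ : ∃ τ, W τ ≠ 0 := Function.ne_iff.mp hWprop.1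
  have hinj : Function.Injective (fun x : SL(2, ℤ) ⧸ Gamma0 N ↦ conjDeltaDil N x τ) := by
    intro x y hxy
    by_contra hne
    apply hτ
    rw [hW, Finset.prod_apply]
    exact Finset.prod_eq_zero (Finset.mem_filter.mpr ⟨Finset.mem_univ (x, y), hne⟩) (by simp [hxy])
  refine ⟨τ, fun hD ↦ ?_⟩
  -- the explicit forms in the basis
  have hspan := fun i : Fin (gamma0Index N) ↦ hb.span (12 * (((gamma0Index N) : ℤ) - 1)) _ (explicitForm_mem N (gamma0Index N) i)
  choose Q hQ hQsum using hspan
  -- the conjugate matrix of the explicit forms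
  set e := cosetEquiv N
  have hF := slash_eq_of_mem_gamma0Space (deltaDil_mem N)
  have hΨ : ∀ a i : Fin (gamma0Index N), cosetSlash N (12 * (((gamma0Index N) : ℤ) - 1)) (explicitForm N (gamma0Index N) i) (e.symm a) τ =
      ∑ j, basisMatrix N wt F τ a j * Q i j τ := by
    intro a i
    unfold cosetSlash
    rw [hQsum i, sum_mul_slash_of_levelOne _ (fun j _ ↦ hQ i j), Finset.sum_apply]
    refine Finset.sum_congr rfl fun j _ ↦ ?_
    rw [Pi.mul_apply, mul_comm]
    rfl
  have hΨ' : ∀ a i : Fin (gamma0Index N), cosetSlash N (12 * (((gamma0Index N) : ℤ) - 1)) (explicitForm N (gamma0Index N) i) (e.symm a) τ =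
      conjDeltaDil N (e.symm a) τ ^ (i : ℕ) * ModularForm.discriminant τ ^ ((gamma0Index N) - 1 - (i : ℕ)) := by
    intro a i
    unfold cosetSlash
    have hi : (i : ℕ) ≤ (gamma0Index N) - 1 := Nat.le_sub_one_of_lt i.2
    rw [show 12 * (((gamma0Index N) : ℤ) - 1) = (((gamma0Index N) - 1 - (i : ℕ) : ℕ) : ℤ) * 12 + ((i : ℕ) : ℤ) * 12 by
      rw [Nat.cast_sub hi, Nat.cast_sub (by omega)]; ring, explicitForm, ← ModularForm.SL_slash,
      ModularForm.mul_slash_SL2, pow_slash_SL2, pow_slash_SL2, ModularForm.SL_slash, discriminant_slash,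
      ModularForm.SL_slash]
    rw [Pi.mul_apply, Pi.pow_apply, Pi.pow_apply, mul_comm]
    rfl
  -- determinants
  have hdet : (Matrix.of fun a i : Fin (gamma0Index N) ↦ cosetSlash N (12 * (((gamma0Index N) : ℤ) - 1)) (explicitForm N (gamma0Index N) i) (e.symm a) τ).det =
      (basisMatrix N wt F τ).det * (Matrix.of fun j i : Fin (gamma0Index N) ↦ Q i j τ).det := by
    rw [← Matrix.det_mul]
    congr 1
    ext a i
    simp only [Matrix.of_apply, Matrix.mul_apply, hΨ]
  have hdet' : (Matrix.of fun a i : Fin (gamma0Index N) ↦ cosetSlash N (12 * (((gamma0Index N) : ℤ) - 1)) (explicitForm N (gamma0Index N) i) (e.symm a) τ).det =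
      (Matrix.vandermonde fun a ↦ conjDeltaDil N (e.symm a) τ).det *
        ∏ i : Fin (gamma0Index N), ModularForm.discriminant τ ^ ((gamma0Index N) - 1 - (i : ℕ)) := by
    rw [← Matrix.det_diagonal, ← Matrix.det_mul]
    congr 1
    ext a i
    simp only [Matrix.of_apply, Matrix.mul_diagonal, Matrix.vandermonde_apply, hΨ']
  have hV : (Matrix.vandermonde fun a ↦ conjDeltaDil N (e.symm a) τ).det ≠ 0 :=
    Matrix.det_vandermonde_ne_zero_iff.mpr fun a b h ↦ e.symm.injective (hinj h)
  have hprod : ∏ i : Fin (gamma0Index N), ModularForm.discriminant τ ^ ((gamma0Index N) - 1 - (i : ℕ)) ≠ 0 :=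
    Finset.prod_ne_zero_iff.mpr fun i _ ↦ pow_ne_zero _ (discriminant_ne_zero τ)
  have : (basisMatrix N wt F τ).det = 0 := hD
  rw [this, zero_mul] at hdet
  rw [hdet] at hdet'
  exact (mul_ne_zero hV hprod) hdet'.symm

/-- **`𝒟¹² = cΔ^K` with `c ≠ 0`; hence `𝒟` has no zero on `ℍ`** (the substitute for the valence
formula in this route). [cite: Gannon2014, Thm. 3.4(b)] -/
theorem exists_basisDet_pow_eq_ne_zero (hb : IsLevelOneBasis N wt F) (hK : 0 ≤ totalWeight N wt) :
    ∃ c : ℂ, c ≠ 0 ∧ ∀ τ, basisDet N wt F τ ^ 12 = c * ModularForm.discriminant τ ^ (totalWeight N wt).toNat := by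
  obtain ⟨c, hc⟩ := exists_basisDet_pow_eq hb hK
  obtain ⟨τ, hτ⟩ := exists_basisDet_ne_zero hb
  refine ⟨c, fun h0 ↦ ?_, hc⟩
  have := hc τ
  rw [h0, zero_mul] at this
  exact pow_ne_zero 12 hτ this

/-- `𝒟(τ) ≠ 0` for every `τ ∈ ℍ`. [cite: Gannon2014, Thm. 3.4(b)] -/
theorem basisDet_ne_zero (hb : IsLevelOneBasis N wt F) (hK : 0 ≤ totalWeight N wt) (τ : ℍ) :
    basisDet N wt F τ ≠ 0 := by
  obtain ⟨c, hc, h⟩ := exists_basisDet_pow_eq_ne_zero hb hK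
  intro h0
  have := h τ
  rw [h0, zero_pow (by norm_num)] at this
  exact mul_ne_zero hc (pow_ne_zero _ (discriminant_ne_zero τ)) this.symm

/-- **Decay of `𝒟` at `i∞`**: `‖𝒟(τ)‖¹² e^{2πK Im τ} → ‖c‖ ≠ 0`. [folklore] -/
theorem tendsto_norm_basisDet_pow (hb : IsLevelOneBasis N wt F) (hK : 0 ≤ totalWeight N wt) :
    ∃ C : ℝ, 0 < C ∧ Tendsto (fun τ : ℍ ↦ ‖basisDet N wt F τ‖ ^ 12 *
      Real.exp (2 * π * ((totalWeight N wt).toNat * τ.im))) atImInfty (𝓝 C) := by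
  obtain ⟨c, hc, h⟩ := exists_basisDet_pow_eq_ne_zero hb hK
  refine ⟨‖c‖, norm_pos_iff.mpr hc, ?_⟩
  have hΔ := tendsto_norm_discriminant_mul_exp.pow (totalWeight N wt).toNat
  rw [one_pow] at hΔ
  have := hΔ.const_mul ‖c‖
  rw [mul_one] at this
  refine this.congr fun τ ↦ ?_
  rw [mul_pow, ← Real.exp_nat_mul, ← norm_pow, ← mul_assoc, ← norm_mul, ← h τ, norm_pow]
  congr 2
  ring

end Determinant

/-! ### Linear algebra: eigenvectors of a permutation of prime order -/

section PermEigen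

variable {μ : ℕ}

/-- Fixed points stay fixed under powers. [folklore] -/
theorem perm_pow_apply_eq_self {σ : Equiv.Perm (Fin μ)} {x : Fin μ} (h : σ x = x) (n : ℕ) :
    (σ ^ n) x = x := by
  induction n with
  | zero => simp
  | succ n ih => rw [pow_succ, Equiv.Perm.mul_apply, h, ih]

/-- For `σᵖ = 1`, `p` prime, a point moved by `σ` is moved by every `σˢ`, `0 < s < p`. [folklore] -/
theorem perm_pow_apply_ne_self {p : ℕ} (hp : p.Prime) {σ : Equiv.Perm (Fin μ)} (hσ : σ ^ p = 1)
    {x : Fin μ} (hx : σ x ≠ x) {s : ℕ} (hs0 : 0 < s) (hsp : s < p) : (σ ^ s) x ≠ x := by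
  intro h
  apply hx
  have hcop : Nat.Coprime s p := (Nat.coprime_of_lt_prime hs0.ne' hsp hp).symm
  obtain ⟨m, -, hm⟩ := Nat.exists_mul_mod_eq_one_of_coprime hcop hp.one_lt
  have h1 : (σ ^ s) ^ m = σ := by
    rw [← pow_mul, ← Nat.div_add_mod (s * m) p, pow_add, pow_mul, hσ, one_pow, one_mul, hm, pow_one]
  have := perm_pow_apply_eq_self (σ := σ ^ s) h m
  rwa [h1] at this

/-- Reduction of exponents modulo `p` when `σᵖ = 1`. [folklore] -/
theorem perm_pow_mod {p : ℕ} {σ : Equiv.Perm (Fin μ)} (hσ : σ ^ p = 1) (n : ℕ) : σ ^ n = σ ^ (n % p) := by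
  conv_lhs => rw [← Nat.div_add_mod n p, pow_add, pow_mul, hσ, one_pow, one_mul]

/-- The `t`-eigenvectors of `v ↦ v ∘ σ`: `v (σ x) = t v x`. [folklore] -/
def permEigenvectors (σ : Equiv.Perm (Fin μ)) (t : ℂ) : Submodule ℂ (Fin μ → ℂ) where
  carrier := {v | ∀ x, v (σ x) = t * v x}
  add_mem' := by
    intro v w hv hw x
    simp only [Pi.add_apply, hv x, hw x]
    ring
  zero_mem' := fun x ↦ by simp
  smul_mem' := by
    intro c v hv x
    simp only [Pi.smul_apply, smul_eq_mul, hv x]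
    ring

/-- Iterating the eigen-relation: `v (σⁿ x) = tⁿ v x`. [folklore] -/
theorem permEigenvectors_pow {σ : Equiv.Perm (Fin μ)} {t : ℂ} {v : Fin μ → ℂ} (hv : v ∈ permEigenvectors σ t)
    (n : ℕ) (x : Fin μ) : v ((σ ^ n) x) = t ^ n * v x := by
  induction n with
  | zero => simp
  | succ n ih =>
    rw [pow_succ', Equiv.Perm.mul_apply, hv, ih]
    ring

/-- The set of minimal representatives of the nontrivial `⟨σ⟩`-orbits (`σᵖ = 1`). [folklore] -/
def permReps (σ : Equiv.Perm (Fin μ)) (p : ℕ) : Finset (Fin μ) :=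
  Finset.univ.filter fun y ↦ σ y ≠ y ∧ ∀ s : ℕ, s < p → y ≤ (σ ^ s) y

/-- **Every moved point lies in the orbit of a minimal representative.** [folklore] -/
theorem exists_permReps {p : ℕ} (hp : p.Prime) {σ : Equiv.Perm (Fin μ)} (hσ : σ ^ p = 1) {x : Fin μ}
    (hx : σ x ≠ x) : ∃ y ∈ permReps σ p, ∃ s < p, x = (σ ^ s) y := by
  classical
  have hp0 : 0 < p := hp.pos
  set S : Finset (Fin μ) := Finset.image (fun s : Fin p ↦ (σ ^ (s : ℕ)) x) Finset.univ with hS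
  have hSne : S.Nonempty := ⟨x, Finset.mem_image.mpr ⟨⟨0, hp0⟩, Finset.mem_univ _, by simp⟩⟩
  obtain ⟨s₀, -, hs₀⟩ := Finset.mem_image.mp (Finset.min'_mem S hSne)
  set m := S.min' hSne with hm
  -- elements of the orbit of `x` are `≥ m`
  have hge : ∀ s : ℕ, m ≤ (σ ^ s) x := fun s ↦ by
    refine Finset.min'_le S _ (Finset.mem_image.mpr ⟨⟨s % p, Nat.mod_lt s hp0⟩, Finset.mem_univ _, ?_⟩)
    simp only [← perm_pow_mod hσ s]
  have hxm : x = (σ ^ ((p - (s₀ : ℕ)) % p)) m := by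
    rw [← perm_pow_mod hσ, ← hs₀, ← Equiv.Perm.mul_apply, ← pow_add, Nat.sub_add_cancel s₀.2.le, hσ,
      Equiv.Perm.one_apply]
  refine ⟨m, ?_, (p - (s₀ : ℕ)) % p, Nat.mod_lt _ hp0, hxm⟩
  rw [permReps, Finset.mem_filter]
  refine ⟨Finset.mem_univ _, fun hfix ↦ hx ?_, fun s _ ↦ ?_⟩
  · rw [hxm, perm_pow_apply_eq_self hfix]
    rw [hxm, perm_pow_apply_eq_self hfix] at hx
    exact absurd hfix hx
  · have h := hge (s + (s₀ : ℕ))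
    rw [pow_add, Equiv.Perm.mul_apply, hs₀] at h
    exact h

/-- Images of representatives are moved points. [folklore] -/
theorem perm_pow_apply_ne_of_mem_permReps {p : ℕ} {σ : Equiv.Perm (Fin μ)} {y : Fin μ}
    (hy : y ∈ permReps σ p) (s : ℕ) : σ ((σ ^ s) y) ≠ (σ ^ s) y := by
  rw [permReps, Finset.mem_filter] at hy
  intro h
  apply hy.2.1
  have : (σ ^ s) (σ y) = (σ ^ s) y := by
    rw [← Equiv.Perm.mul_apply, ← pow_succ, pow_succ', Equiv.Perm.mul_apply, h]
  exact (σ ^ s).injective this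

/-- **`p · #reps ≤ #(moved points)`**: the map `(y, s) ↦ σˢ y` on `reps × [0, p)` is injective with
values in the moved points. [folklore] -/
theorem mul_card_permReps_le {p : ℕ} (hp : p.Prime) {σ : Equiv.Perm (Fin μ)} (hσ : σ ^ p = 1) :
    p * (permReps σ p).card ≤ (Finset.univ.filter fun x : Fin μ ↦ σ x ≠ x).card := by
  classical
  have hp0 : 0 < p := hp.pos
  let f : Fin μ × Fin p → Fin μ := fun q ↦ (σ ^ (q.2 : ℕ)) q.1
  have hinj : Set.InjOn f ((permReps σ p) ×ˢ (Finset.univ : Finset (Fin p)) : Finset (Fin μ × Fin p)) := by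
    rintro ⟨y, s⟩ hys ⟨y', s'⟩ hys' h
    simp only [Finset.coe_product, Set.mem_prod, Finset.mem_coe] at hys hys'
    have hy := hys.1
    have hy' := hys'.1
    simp only [f] at h
    -- `y' = σ^r y`
    have hr : y' = (σ ^ (((s : ℕ) + (p - (s' : ℕ))) % p)) y := by
      rw [← perm_pow_mod hσ, pow_add, Equiv.Perm.mul_apply]
      have : (σ ^ (p - (s' : ℕ))) ((σ ^ (s' : ℕ)) y') = y' := by
        rw [← Equiv.Perm.mul_apply, ← pow_add, Nat.sub_add_cancel s'.2.le, hσ, Equiv.Perm.one_apply]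
      rw [← this, ← h, ← Equiv.Perm.mul_apply, ← Equiv.Perm.mul_apply, ← pow_add, ← pow_add, add_comm]
    have hr' : y = (σ ^ (((s' : ℕ) + (p - (s : ℕ))) % p)) y' := by
      rw [← perm_pow_mod hσ, pow_add, Equiv.Perm.mul_apply]
      have : (σ ^ (p - (s : ℕ))) ((σ ^ (s : ℕ)) y) = y := by
        rw [← Equiv.Perm.mul_apply, ← pow_add, Nat.sub_add_cancel s.2.le, hσ, Equiv.Perm.one_apply]
      rw [← this, h, ← Equiv.Perm.mul_apply, ← Equiv.Perm.mul_apply, ← pow_add, ← pow_add, add_comm]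
    have hyy' : y = y' := by
      have h1 := (Finset.mem_filter.mp hy).2.2 (((s : ℕ) + (p - (s' : ℕ))) % p) (Nat.mod_lt _ hp0)
      have h2 := (Finset.mem_filter.mp hy').2.2 (((s' : ℕ) + (p - (s : ℕ))) % p) (Nat.mod_lt _ hp0)
      rw [← hr] at h1
      rw [← hr'] at h2
      exact le_antisymm h1 h2
    subst hyy'
    -- now `σ^s y = σ^{s'} y` forces `s = s'`
    have hss' : (s : ℕ) = s' := by
      by_contra hne
      rcases Nat.lt_or_gt_of_ne hne with hlt | hlt
      · have : (σ ^ ((s' : ℕ) - s)) y = y := by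
          have e : (σ ^ (s : ℕ)) ((σ ^ ((s' : ℕ) - s)) y) = (σ ^ (s : ℕ)) y := by
            rw [← Equiv.Perm.mul_apply, ← pow_add, Nat.add_sub_cancel' hlt.le, ← h]
          exact (σ ^ (s : ℕ)).injective e
        exact perm_pow_apply_ne_self hp hσ (Finset.mem_filter.mp hy).2.1 (by omega) (by omega) this
      · have : (σ ^ ((s : ℕ) - s')) y = y := by
          have e : (σ ^ (s' : ℕ)) ((σ ^ ((s : ℕ) - s')) y) = (σ ^ (s' : ℕ)) y := by
            rw [← Equiv.Perm.mul_apply, ← pow_add, Nat.add_sub_cancel' hlt.le, h]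
          exact (σ ^ (s' : ℕ)).injective e
        exact perm_pow_apply_ne_self hp hσ (Finset.mem_filter.mp hy).2.1 (by omega) (by omega) this
    exact Prod.ext rfl (Fin.ext hss')
  have himage : Finset.image f ((permReps σ p) ×ˢ Finset.univ) ⊆ Finset.univ.filter fun x : Fin μ ↦ σ x ≠ x := by
    intro x hx
    obtain ⟨⟨y, s⟩, hys, rfl⟩ := Finset.mem_image.mp hx
    rw [Finset.mem_filter]
    exact ⟨Finset.mem_univ _, perm_pow_apply_ne_of_mem_permReps (Finset.mem_product.mp hys).1 _⟩
  calc p * (permReps σ p).card = ((permReps σ p) ×ˢ (Finset.univ : Finset (Fin p))).card := by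
        rw [Finset.card_product, Finset.card_univ, Fintype.card_fin, mul_comm]
    _ = (Finset.image f ((permReps σ p) ×ˢ Finset.univ)).card := (Finset.card_image_of_injOn hinj).symm
    _ ≤ _ := Finset.card_le_card himage

/-- An eigenvector vanishing on the representatives (and, for `t = 1`, on the fixed points) is zero.
[folklore] -/
theorem permEigenvectors_eq_zero {p : ℕ} (hp : p.Prime) {σ : Equiv.Perm (Fin μ)} (hσ : σ ^ p = 1)
    {t : ℂ} {v : Fin μ → ℂ} (hv : v ∈ permEigenvectors σ t)
    (hreps : ∀ y ∈ permReps σ p, v y = 0) (hfix : ∀ x, σ x = x → t = 1 → v x = 0) : v = 0 := by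
  funext x
  by_cases hx : σ x = x
  · by_cases ht : t = 1
    · exact hfix x hx ht
    · have := hv x
      rw [hx] at this
      have : (1 - t) * v x = 0 := by linear_combination this
      exact (mul_eq_zero.mp this).resolve_left (sub_ne_zero.mpr (Ne.symm ht))
  · obtain ⟨y, hy, s, -, rfl⟩ := exists_permReps hp hσ hx
    rw [permEigenvectors_pow hv, hreps y hy, mul_zero]
    rfl

/-- **Counting eigenvectors**: a linearly independent family of `t`-eigenvectors has at most `#D`
members whenever vanishing on `D` forces a `t`-eigenvector to vanish. [folklore] -/
theorem card_le_of_linearIndependent_permEigenvectors {σ : Equiv.Perm (Fin μ)} {t : ℂ}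
    (D : Finset (Fin μ)) (hD : ∀ v ∈ permEigenvectors σ t, (∀ x ∈ D, v x = 0) → v = 0)
    {ι : Type*} [Fintype ι] (v : ι → Fin μ → ℂ) (hli : LinearIndependent ℂ v)
    (hv : ∀ i, v i ∈ permEigenvectors σ t) : Fintype.card ι ≤ D.card := by
  classical
  let w : ι → (D → ℂ) := fun i d ↦ v i d
  have hw : LinearIndependent ℂ w := by
    rw [Fintype.linearIndependent_iff]
    intro c hc
    have hsum : ∑ i, c i • v i = 0 := by
      refine hD _ (Submodule.sum_mem _ fun i _ ↦ Submodule.smul_mem _ _ (hv i)) fun x hx ↦ ?_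
      have := congrFun hc ⟨x, hx⟩
      simpa [w, Finset.sum_apply, Pi.smul_apply] using this
    exact Fintype.linearIndependent_iff.mp hli c hsum
  have := hw.fintype_card_le_finrank
  rwa [Module.finrank_fintype_fun_eq_card, Fintype.card_coe] at this

/-- **The eigen-count inequalities** for a permutation `σ` of `Fin μ` with `σᵖ = 1`, `p` prime, `F`
fixed points, and a linearly independent family `(v_i)` with `v_i ∘ σ = t_i v_i`:
`p · #{i : t_i = c} + F ≤ μ` for `c ≠ 1`, and `p · #{i : t_i = 1} ≤ μ + (p - 1) F`. [folklore] -/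
theorem eigenCount_le {p : ℕ} (hp : p.Prime) (σ : Equiv.Perm (Fin μ)) (hσ : σ ^ p = 1)
    {ι : Type*} [Fintype ι] [DecidableEq ι] (v : ι → Fin μ → ℂ) (hli : LinearIndependent ℂ v)
    (t : ι → ℂ) (ht : ∀ i x, v i (σ x) = t i * v i x) :
    (∀ c : ℂ, c ≠ 1 → p * (Finset.univ.filter fun i ↦ t i = c).card +
        (Finset.univ.filter fun x : Fin μ ↦ σ x = x).card ≤ μ) ∧
    p * (Finset.univ.filter fun i ↦ t i = 1).card ≤
      μ + (p - 1) * (Finset.univ.filter fun x : Fin μ ↦ σ x = x).card := by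
  classical
  set Fix := Finset.univ.filter fun x : Fin μ ↦ σ x = x with hFix
  set Mov := Finset.univ.filter fun x : Fin μ ↦ σ x ≠ x with hMov
  have hsplit : Fix.card + Mov.card = μ := by
    rw [hFix, hMov, Finset.card_filter_add_card_filter_not, Finset.card_univ, Fintype.card_fin]
  have hreps := mul_card_permReps_le hp hσ
  -- class `c`: the subfamily
  have hclass : ∀ (c : ℂ) (D : Finset (Fin μ)),
      (∀ v ∈ permEigenvectors σ c, (∀ x ∈ D, v x = 0) → v = 0) →
      (Finset.univ.filter fun i ↦ t i = c).card ≤ D.card := by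
    intro c D hD
    have := card_le_of_linearIndependent_permEigenvectors D hD
      (fun i : {i // t i = c} ↦ v i) (hli.comp Subtype.val Subtype.val_injective)
      (fun i x ↦ by rw [ht, i.2])
    rwa [Fintype.card_subtype] at this
  refine ⟨fun c hc ↦ ?_, ?_⟩
  · have h1 := hclass c (permReps σ p) fun v hv h0 ↦
      permEigenvectors_eq_zero hp hσ hv h0 fun _ _ h1 ↦ absurd h1 hc
    calc p * (Finset.univ.filter fun i ↦ t i = c).card + Fix.card
        ≤ p * (permReps σ p).card + Fix.card := by gcongr
      _ ≤ Mov.card + Fix.card := by gcongr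
      _ = μ := by omega
  · have h1 := hclass 1 (permReps σ p ∪ Fix) fun v hv h0 ↦
      permEigenvectors_eq_zero hp hσ hv (fun y hy ↦ h0 y (Finset.mem_union_left _ hy))
        fun x hx _ ↦ h0 x (Finset.mem_union_right _ (by rw [hFix, Finset.mem_filter]; exact ⟨Finset.mem_univ _, hx⟩))
    have h2 : (permReps σ p ∪ Fix).card ≤ (permReps σ p).card + Fix.card := Finset.card_union_le _ _
    have hp1 : 1 ≤ p := hp.one_lt.le
    calc p * (Finset.univ.filter fun i ↦ t i = 1).card ≤ p * ((permReps σ p).card + Fix.card) := by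
          gcongr
          exact h1.trans h2
      _ = p * (permReps σ p).card + p * Fix.card := by ring
      _ ≤ Mov.card + p * Fix.card := by gcongr
      _ = μ + (p - 1) * Fix.card := by
          have : Fix.card ≤ p * Fix.card := Nat.le_mul_of_pos_left _ hp.pos
          have e : (p - 1) * Fix.card = p * Fix.card - Fix.card := by rw [Nat.sub_mul, one_mul]
          omega

end PermEigen

/-! ### The weights modulo `4` and modulo `6` (elliptic points `i` and `ρ`) -/

section Elliptic

variable (N : ℕ) [NeZero N]

/-- The finite coset space `SL₂(ℤ)/Γ₀(N)` as a `Fintype` (local, from `Finite`), to sum over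
cosets and to use `Fintype.equivFin`. [folklore] -/
local instance : Fintype (SL(2, ℤ) ⧸ Gamma0 N) := Fintype.ofFinite _

/-- The permutation of `Fin μ ≃ SL₂(ℤ)/Γ₀(N)` induced by `q ↦ h⁻¹ q`. [folklore] -/
def cosetPermFin (h : SL(2, ℤ)) : Equiv.Perm (Fin (gamma0Index N)) :=
  (cosetEquiv N).symm.trans ((MulAction.toPerm h⁻¹).trans (cosetEquiv N))

/-- Formula for `cosetPermFin`. [folklore] -/
theorem cosetPermFin_apply (h : SL(2, ℤ)) (a : Fin (gamma0Index N)) :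
    cosetPermFin N h a = cosetEquiv N (h⁻¹ • (cosetEquiv N).symm a) := rfl

/-- Powers of `cosetPermFin`. [folklore] -/
theorem cosetPermFin_pow_apply (h : SL(2, ℤ)) (n : ℕ) (a : Fin (gamma0Index N)) :
    (cosetPermFin N h ^ n) a = cosetEquiv N ((h⁻¹) ^ n • (cosetEquiv N).symm a) := by
  induction n generalizing a with
  | zero => simp
  | succ n ih =>
    rw [pow_succ, Equiv.Perm.mul_apply, cosetPermFin_apply, ih, Equiv.symm_apply_apply, smul_smul, ← pow_succ]

/-- If `hᵖ = -1` then `cosetPermFin h` has order dividing `p`. [folklore] -/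
theorem cosetPermFin_pow_eq_one {h : SL(2, ℤ)} {p : ℕ} (hh : h ^ p = -1) : cosetPermFin N h ^ p = 1 := by
  ext a
  rw [cosetPermFin_pow_apply, inv_pow, hh, show (-1 : SL(2, ℤ))⁻¹ = -1 by simp, neg_one_smul_coset,
    Equiv.apply_symm_apply, Equiv.Perm.one_apply]

/-- Fixed points of `cosetPermFin h` correspond to cosets fixed by `h`. [folklore] -/
theorem card_fixed_cosetPermFin (h : SL(2, ℤ)) :
    (Finset.univ.filter fun a ↦ cosetPermFin N h a = a).card =
      Nat.card {q : SL(2, ℤ) ⧸ Gamma0 N // h • q = q} := by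
  classical
  rw [Nat.card_eq_fintype_card, Fintype.card_subtype]
  refine Finset.card_bij (fun a _ ↦ (cosetEquiv N).symm a) (fun a ha ↦ ?_)
    (fun a _ b _ hab ↦ (cosetEquiv N).symm.injective hab) (fun q hq ↦ ⟨cosetEquiv N q, ?_, by simp⟩)
  · rw [Finset.mem_filter] at ha ⊢
    refine ⟨Finset.mem_univ _, ?_⟩
    have := congrArg (cosetEquiv N).symm ha.2
    rw [cosetPermFin_apply, Equiv.symm_apply_apply, inv_smul_eq_iff] at this
    exact this.symm
  · rw [Finset.mem_filter] at hq ⊢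
    refine ⟨Finset.mem_univ _, ?_⟩
    rw [cosetPermFin_apply, Equiv.symm_apply_apply]
    congr 1
    rw [inv_smul_eq_iff, hq.2]

variable {N} {wt : Fin (gamma0Index N) → ℤ} {F : Fin (gamma0Index N) → ℍ → ℂ}

/-- **The eigen-relation at a fixed point**: if `h z₀ = z₀` then
`Φ(z₀)_{h⁻¹a, j} = j(h, z₀)^{-k_j} Φ(z₀)_{a,j}` (covariance of `Φ`). [folklore] -/
theorem basisMatrix_cosetPermFin (hb : IsLevelOneBasis N wt F) {h : SL(2, ℤ)} {z₀ : ℍ} (hz : h • z₀ = z₀)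
    (a j : Fin (gamma0Index N)) :
    basisMatrix N wt F z₀ (cosetPermFin N h a) j = denom h z₀ ^ (-wt j) * basisMatrix N wt F z₀ a j := by
  have hF := slash_eq_of_mem_gamma0Space (hb.mem j)
  unfold basisMatrix
  rw [cosetPermFin_apply, Equiv.symm_apply_apply, ← cosetSlash_slash hF, ← ModularForm.SL_slash,
    ModularForm.SL_slash_apply, hz, mul_comm]

/-- The columns of `Φ(τ)` are linearly independent (`𝒟(τ) ≠ 0`). [folklore] -/
theorem linearIndependent_basisMatrix_col (hb : IsLevelOneBasis N wt F) (hK : 0 ≤ totalWeight N wt) (τ : ℍ) :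
    LinearIndependent ℂ (fun j a ↦ basisMatrix N wt F τ a j) := by
  have : IsUnit (basisMatrix N wt F τ) :=
    (Matrix.isUnit_iff_isUnit_det _).mpr (isUnit_iff_ne_zero.mpr (basisDet_ne_zero hb hK τ))
  exact Matrix.linearIndependent_cols_iff_isUnit.mpr this

omit [NeZero N] in
/-- `0 ≤ K` when all weights are `≥ 0`. [folklore] -/
theorem totalWeight_nonneg (hwt : ∀ j, 0 ≤ wt j ∧ Even (wt j)) : 0 ≤ totalWeight N wt :=
  Finset.sum_nonneg fun j _ ↦ (hwt j).1

/-- `S · i = i`. [folklore] -/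
theorem S_smul_I : ModularGroup.S • UpperHalfPlane.I = UpperHalfPlane.I := by
  apply UpperHalfPlane.ext
  rw [UpperHalfPlane.modular_S_smul]
  simp [UpperHalfPlane.coe_I]

/-- `S² = -1`, `(ST)³ = -1` in `SL₂(ℤ)`. [folklore] -/
theorem S_sq_eq : ModularGroup.S ^ 2 = (-1 : SL(2, ℤ)) := by decide

/-- `(ST)³ = -1` in `SL₂(ℤ)`. [folklore] -/
theorem ST_pow_three_eq : (ModularGroup.S * ModularGroup.T) ^ 3 = (-1 : SL(2, ℤ)) := by decide

/-- `ρ³ = 1` for Mathlib's `ρ = e^{2πi/3}`. [folklore] -/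
theorem rho_pow_three : (UpperHalfPlane.ρ : ℂ) ^ 3 = 1 := by
  have h := UpperHalfPlane.ρ_sq
  linear_combination (UpperHalfPlane.ρ - 1 : ℂ) * h

/-- `ρ ≠ 1`, `ρ² ≠ 1`. [folklore] -/
theorem rho_ne_one : (UpperHalfPlane.ρ : ℂ) ≠ 1 ∧ (UpperHalfPlane.ρ : ℂ) ^ 2 ≠ 1 := by
  have him : (UpperHalfPlane.ρ : ℂ).im = Real.sqrt 3 / 2 := rfl
  have hpos : 0 < Real.sqrt 3 / 2 := by positivity
  constructor
  · intro h
    have := congrArg Complex.im h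
    rw [him, Complex.one_im] at this
    linarith
  · intro h
    rw [UpperHalfPlane.ρ_sq] at h
    have := congrArg Complex.im h
    simp only [Complex.sub_im, Complex.neg_im, him, Complex.one_im] at this
    linarith

/-- Entries of `ST = (0 -1; 1 1)`. [folklore] -/
theorem ST_apply : (ModularGroup.S * ModularGroup.T : SL(2, ℤ)) 0 0 = 0 ∧
    (ModularGroup.S * ModularGroup.T : SL(2, ℤ)) 0 1 = -1 ∧
    (ModularGroup.S * ModularGroup.T : SL(2, ℤ)) 1 0 = 1 ∧ (ModularGroup.S * ModularGroup.T : SL(2, ℤ)) 1 1 = 1 := by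
  have hST : ((ModularGroup.S * ModularGroup.T : SL(2, ℤ)) : Matrix (Fin 2) (Fin 2) ℤ) = !![0, -1; 1, 1] := by
    decide
  refine ⟨?_, ?_, ?_, ?_⟩ <;>
  · show ((ModularGroup.S * ModularGroup.T : SL(2, ℤ)) : Matrix (Fin 2) (Fin 2) ℤ) _ _ = _
    rw [hST]
    rfl

/-- `ρ + 1 ≠ 0`. [folklore] -/
theorem rho_add_one_ne_zero : (UpperHalfPlane.ρ : ℂ) + 1 ≠ 0 := by
  intro h
  have := congrArg Complex.im h
  simp only [Complex.add_im, Complex.one_im, add_zero, Complex.zero_im] at this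
  have him : (UpperHalfPlane.ρ : ℂ).im = Real.sqrt 3 / 2 := rfl
  rw [him] at this
  have : (0 : ℝ) < Real.sqrt 3 / 2 := by positivity
  linarith

/-- `(ST) · ρ = ρ`. [folklore] -/
theorem ST_smul_rho : (ModularGroup.S * ModularGroup.T) • UpperHalfPlane.ρ = UpperHalfPlane.ρ := by
  have hsq := UpperHalfPlane.ρ_sq
  obtain ⟨h00, h01, h10, h11⟩ := ST_apply
  apply UpperHalfPlane.ext
  rw [UpperHalfPlane.coe_specialLinearGroup_apply, h00, h01, h10, h11]
  simp only [map_zero, map_neg, map_one, Complex.ofReal_zero, Complex.ofReal_neg, Complex.ofReal_one,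
    zero_mul, zero_add, one_mul]
  rw [div_eq_iff rho_add_one_ne_zero]
  linear_combination -hsq

/-- `j(ST, ρ) = ρ + 1`. [folklore] -/
theorem denom_ST_rho :
    denom ((ModularGroup.S * ModularGroup.T : SL(2, ℤ)) : GL (Fin 2) ℝ) UpperHalfPlane.ρ = UpperHalfPlane.ρ + 1 := by
  obtain ⟨-, -, h10, h11⟩ := ST_apply
  rw [ModularGroup.denom_apply, h10, h11]
  simp

/-- `i^{-2n} = (-1)ⁿ`. [folklore] -/
theorem I_zpow_neg_two_mul (n : ℕ) : Complex.I ^ (-(2 * (n : ℤ))) = (-1) ^ n := by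
  rw [zpow_neg, show (2 * (n : ℤ)) = ((2 * n : ℕ) : ℤ) by push_cast; ring, zpow_natCast, pow_mul,
    Complex.I_sq, inv_eq_iff_eq_inv]
  rw [← inv_pow, inv_neg, inv_one]

/-- `(ρ+1)^{-2n} = (ρⁿ)⁻¹` (as `(ρ + 1)² = ρ`). [folklore] -/
theorem rho_add_one_zpow_neg_two_mul (n : ℕ) :
    ((UpperHalfPlane.ρ : ℂ) + 1) ^ (-(2 * (n : ℤ))) = ((UpperHalfPlane.ρ : ℂ) ^ n)⁻¹ := by
  have h2 : ((UpperHalfPlane.ρ : ℂ) + 1) ^ 2 = UpperHalfPlane.ρ := by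
    linear_combination UpperHalfPlane.ρ_sq
  rw [zpow_neg, show (2 * (n : ℤ)) = ((2 * n : ℕ) : ℤ) by push_cast; ring, zpow_natCast, pow_mul, h2]

/-- Even nonnegative weights are `2n`. [folklore] -/
theorem exists_eq_two_mul {w : ℤ} (h0 : 0 ≤ w) (he : Even w) : ∃ n : ℕ, w = 2 * (n : ℤ) := by
  obtain ⟨r, hr⟩ := he
  refine ⟨r.toNat, ?_⟩
  rw [Int.toNat_of_nonneg (by omega)]
  omega

/-- The common core of the two counts: the eigen-count inequalities for `h` with `hᵖ = -1` fixing
`z₀`, applied to the columns of `Φ(z₀)`. [folklore] -/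
theorem eigenCount_basisMatrix (hb : IsLevelOneBasis N wt F) (hwt : ∀ j, 0 ≤ wt j ∧ Even (wt j))
    {h : SL(2, ℤ)} {p : ℕ} (hp : p.Prime) (hh : h ^ p = -1) {z₀ : ℍ} (hz : h • z₀ = z₀) :
    (∀ c : ℂ, c ≠ 1 → p * (Finset.univ.filter fun j ↦ denom h z₀ ^ (-wt j) = c).card +
        Nat.card {q : SL(2, ℤ) ⧸ Gamma0 N // h • q = q} ≤ gamma0Index N) ∧
    p * (Finset.univ.filter fun j ↦ denom h z₀ ^ (-wt j) = 1).card ≤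
      gamma0Index N + (p - 1) * Nat.card {q : SL(2, ℤ) ⧸ Gamma0 N // h • q = q} := by
  classical
  have := eigenCount_le hp (cosetPermFin N h) (cosetPermFin_pow_eq_one N hh)
    (fun j a ↦ basisMatrix N wt F z₀ a j) (linearIndependent_basisMatrix_col hb (totalWeight_nonneg hwt) z₀)
    (fun j ↦ denom h z₀ ^ (-wt j)) (fun j a ↦ basisMatrix_cosetPermFin hb hz a j)
  rwa [card_fixed_cosetPermFin] at this

/-- **Weights modulo `4`**: `2 · #{j : 4 ∣ k_j} = μ + ν₂` and `2 · #{j : 4 ∤ k_j} + ν₂ = μ`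
(the columns of `Φ(i)` are `±1`-eigenvectors of the coset permutation of `S`, with eigenvalue
`i^{-k_j} = 1` iff `4 ∣ k_j`; `S` has `ν₂` fixed cosets). [cite: Gannon2014, Thm. 3.4(b)] -/
theorem two_mul_card_four_dvd (hb : IsLevelOneBasis N wt F) (hwt : ∀ j, 0 ≤ wt j ∧ Even (wt j)) :
    2 * (Finset.univ.filter fun j ↦ (4 : ℤ) ∣ wt j).card = gamma0Index N + nu₂ N ∧
    2 * (Finset.univ.filter fun j ↦ ¬ (4 : ℤ) ∣ wt j).card + nu₂ N = gamma0Index N := by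
  classical
  obtain ⟨hne, h1⟩ := eigenCount_basisMatrix hb hwt Nat.prime_two S_sq_eq S_smul_I
  rw [card_fixed_S_eq_nu₂] at hne h1
  have hden : denom ModularGroup.S UpperHalfPlane.I = Complex.I := by
    rw [ModularGroup.denom_S]; rfl
  simp only [hden] at hne h1
  -- identify the classes
  have hcls : ∀ j, (Complex.I ^ (-wt j) = 1 ↔ (4 : ℤ) ∣ wt j) ∧ (Complex.I ^ (-wt j) = -1 ↔ ¬ (4 : ℤ) ∣ wt j) := by
    intro j
    obtain ⟨n, hn⟩ := exists_eq_two_mul (hwt j).1 (hwt j).2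
    rw [hn, I_zpow_neg_two_mul]
    have h4 : (4 : ℤ) ∣ 2 * (n : ℤ) ↔ Even n := by
      constructor
      · rintro ⟨k, hk⟩; exact ⟨k.toNat, by omega⟩
      · rintro ⟨k, hk⟩; exact ⟨k, by omega⟩
    rw [h4]
    have h11 : (1 : ℂ) ≠ -1 := by norm_num
    have h11' : (-1 : ℂ) ≠ 1 := by norm_num
    rcases Nat.even_or_odd n with he | ho
    · simp [he.neg_one_pow, he, h11]
    · simp [ho.neg_one_pow, Nat.not_even_iff_odd.mpr ho, h11']
  have e1 : (Finset.univ.filter fun j ↦ Complex.I ^ (-wt j) = 1) = Finset.univ.filter fun j ↦ (4 : ℤ) ∣ wt j :=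
    Finset.filter_congr fun j _ ↦ (hcls j).1
  have e2 : (Finset.univ.filter fun j ↦ Complex.I ^ (-wt j) = -1) = Finset.univ.filter fun j ↦ ¬ (4 : ℤ) ∣ wt j :=
    Finset.filter_congr fun j _ ↦ (hcls j).2
  have hsum : (Finset.univ.filter fun j ↦ (4 : ℤ) ∣ wt j).card +
      (Finset.univ.filter fun j ↦ ¬ (4 : ℤ) ∣ wt j).card = gamma0Index N := by
    rw [Finset.card_filter_add_card_filter_not, Finset.card_univ, Fintype.card_fin]
  have hA := hne (-1) (by norm_num)
  rw [e2] at hA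
  rw [e1] at h1
  omega

/-- **Weights modulo `6`**: `3 · #{j : 6 ∣ k_j} = μ + 2ν₃`, `3 · #{j : k_j ≡ 2 (6)} + ν₃ = μ`,
`3 · #{j : k_j ≡ 4 (6)} + ν₃ = μ` (eigenvectors of the coset permutation of `ST`, `(ST)³ = -1`,
fixed point `ρ`, eigenvalues `(ρ+1)^{-k_j} ∈ {1, ρ², ρ}`; `ν₃` fixed cosets). [cite: Gannon2014, Thm. 3.4(b)] -/
theorem three_mul_card_six_dvd (hb : IsLevelOneBasis N wt F) (hwt : ∀ j, 0 ≤ wt j ∧ Even (wt j)) :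
    3 * (Finset.univ.filter fun j ↦ (6 : ℤ) ∣ wt j).card = gamma0Index N + 2 * nu₃ N ∧
    3 * (Finset.univ.filter fun j ↦ wt j % 6 = 2).card + nu₃ N = gamma0Index N ∧
    3 * (Finset.univ.filter fun j ↦ wt j % 6 = 4).card + nu₃ N = gamma0Index N := by
  classical
  obtain ⟨hne, h1⟩ := eigenCount_basisMatrix hb hwt Nat.prime_three ST_pow_three_eq ST_smul_rho
  -- fixed cosets of `ST` are as many as those of `TS = T (ST) T⁻¹`
  have hfix : Nat.card {q : SL(2, ℤ) ⧸ Gamma0 N // (ModularGroup.S * ModularGroup.T) • q = q} = nu₃ N := by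
    rw [← card_fixed_TS_eq_nu₃ N]
    refine Nat.card_congr (Equiv.subtypeEquiv (MulAction.toPerm (ModularGroup.T : SL(2, ℤ))) fun q ↦ ?_)
    simp only [MulAction.toPerm_apply, smul_smul]
    rw [show ModularGroup.T * ModularGroup.S * ModularGroup.T = ModularGroup.T * (ModularGroup.S * ModularGroup.T) by group,
      ← smul_smul (ModularGroup.T) (ModularGroup.S * ModularGroup.T) q]
    exact (MulAction.injective (ModularGroup.T : SL(2, ℤ))).eq_iff.symm
  rw [hfix, denom_ST_rho] at hne h1
  set ρ' : ℂ := (UpperHalfPlane.ρ : ℂ) with hρ'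
  have hρ3 : ρ' ^ 3 = 1 := rho_pow_three
  obtain ⟨hρ1, hρ2⟩ := rho_ne_one
  -- identify the classes
  have hcls : ∀ j, ((ρ' + 1) ^ (-wt j) = 1 ↔ (6 : ℤ) ∣ wt j) ∧ ((ρ' + 1) ^ (-wt j) = ρ' ^ 2 ↔ wt j % 6 = 2) ∧
      ((ρ' + 1) ^ (-wt j) = ρ' ↔ wt j % 6 = 4) := by
    intro j
    obtain ⟨n, hn⟩ := exists_eq_two_mul (hwt j).1 (hwt j).2
    rw [hn, rho_add_one_zpow_neg_two_mul]
    have hpow : ρ' ^ n = ρ' ^ (n % 3) := by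
      conv_lhs => rw [← Nat.div_add_mod n 3, pow_add, pow_mul, hρ3, one_pow, one_mul]
    rw [hpow]
    have h6 : ((6 : ℤ) ∣ 2 * (n : ℤ) ↔ n % 3 = 0) ∧ (2 * (n : ℤ) % 6 = 2 ↔ n % 3 = 1) ∧
        (2 * (n : ℤ) % 6 = 4 ↔ n % 3 = 2) := by omega
    rw [h6.1, h6.2.1, h6.2.2]
    have hρ0 : ρ' ≠ 0 := fun h ↦ by rw [h] at hρ3; norm_num at hρ3
    have hinv1 : ρ'⁻¹ = ρ' ^ 2 := inv_eq_of_mul_eq_one_right (by rw [← pow_succ', hρ3])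
    have hinv2 : (ρ' ^ 2)⁻¹ = ρ' := inv_eq_of_mul_eq_one_right (by rw [← pow_succ, hρ3])
    have hne21 : ρ' ^ 2 ≠ ρ' := fun h ↦ hρ1 (by
      have : ρ' * ρ' = ρ' * 1 := by rw [mul_one, ← pow_two, h]
      exact mul_left_cancel₀ hρ0 this)
    obtain ⟨r, hr, hr3⟩ : ∃ r, n % 3 = r ∧ r < 3 := ⟨n % 3, rfl, Nat.mod_lt _ (by norm_num)⟩
    rw [hr]
    interval_cases r <;> simp only [pow_zero, inv_one, pow_one, hinv1, hinv2]
    · exact ⟨by simp, iff_of_false (fun h ↦ hρ2 h.symm) (by norm_num),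
        iff_of_false (fun h ↦ hρ1 h.symm) (by norm_num)⟩
    · exact ⟨iff_of_false hρ2 (by norm_num), by simp, iff_of_false hne21 (by norm_num)⟩
    · exact ⟨iff_of_false hρ1 (by norm_num), iff_of_false (Ne.symm hne21) (by norm_num), by simp⟩
  have e0 : (Finset.univ.filter fun j ↦ (ρ' + 1) ^ (-wt j) = 1) = Finset.univ.filter fun j ↦ (6 : ℤ) ∣ wt j :=
    Finset.filter_congr fun j _ ↦ (hcls j).1
  have e2 : (Finset.univ.filter fun j ↦ (ρ' + 1) ^ (-wt j) = ρ' ^ 2) = Finset.univ.filter fun j ↦ wt j % 6 = 2 :=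
    Finset.filter_congr fun j _ ↦ (hcls j).2.1
  have e4 : (Finset.univ.filter fun j ↦ (ρ' + 1) ^ (-wt j) = ρ') = Finset.univ.filter fun j ↦ wt j % 6 = 4 :=
    Finset.filter_congr fun j _ ↦ (hcls j).2.2
  -- the three classes partition the generators
  have hsum : (Finset.univ.filter fun j ↦ (6 : ℤ) ∣ wt j).card + (Finset.univ.filter fun j ↦ wt j % 6 = 2).card +
      (Finset.univ.filter fun j ↦ wt j % 6 = 4).card = gamma0Index N := by
    have htri : ∀ j, ((6 : ℤ) ∣ wt j ∨ wt j % 6 = 2 ∨ wt j % 6 = 4) ∧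
        ¬ ((6 : ℤ) ∣ wt j ∧ wt j % 6 = 2) ∧ ¬ ((6 : ℤ) ∣ wt j ∧ wt j % 6 = 4) ∧ ¬ (wt j % 6 = 2 ∧ wt j % 6 = 4) := by
      intro j
      obtain ⟨n, hn⟩ := exists_eq_two_mul (hwt j).1 (hwt j).2
      omega
    rw [← Finset.card_union_of_disjoint (Finset.disjoint_filter.mpr fun j _ h h' ↦ (htri j).2.1 ⟨h, h'⟩),
      ← Finset.filter_or, ← Finset.card_union_of_disjoint (Finset.disjoint_filter.mpr fun j _ h h' ↦ by
        rcases h with h | h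
        · exact (htri j).2.2.1 ⟨h, h'⟩
        · exact (htri j).2.2.2 ⟨h, h'⟩), ← Finset.filter_or]
    rw [Finset.filter_true_of_mem (fun j _ ↦ by have := (htri j).1; tauto), Finset.card_univ,
      Fintype.card_fin]
  have hA := hne (ρ' ^ 2) hρ2
  have hB := hne ρ' hρ1
  rw [e2] at hA
  rw [e4] at hB
  rw [e0] at h1
  omega

end Elliptic

end Literature.NumberTheory.EllipticCurves.ModularForms
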